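/-
Copyright (c) 2026. All rights reserved.
Released under Apache 2.0 license as described in the file LICENSE.
-/
import Literature.AlgebraicGeometry.Pohlmann1968.DegenerateCMTypesAbelianCMFieldExponentTwicePrime
import Literature.AlgebraicGeometry.Pohlmann1968.DegenerateCMTypesAbelianCMFieldCyclicQuarticSubfields
import Literature.NumberTheory.ComplexMultiplication.DegenerateCMTypesAbelianKernelsIndexFourMulPrime
import HarnessLib

/-!
# ABELIAN CM fields with Galois group of EXPONENT `4p` (`(ℤ/2)^r × (ℤ/4)^s × (ℤ/p)^t`, `p` an odd prime): the rank of every CM type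
# is `[K:ℚ]/2 + 1 − b(Φ) − 2e₄(Φ) − (p − 1)e_{2p}(Φ) − 2(p − 1)e_{4p}(Φ)`; the nondegeneracy criterion and the Hodge conjecture for
# all powers off the four lists; `ℚ(ζ₃₅), ℚ(ζ₃₉), ℚ(ζ₄₅), ℚ(ζ₅₂), ℚ(ζ₇₀), ℚ(ζ₇₈), ℚ(ζ₉₀)` (`Rank + b + 2e₄ + 2e₆ + 4e₁₂ = 13`)

Topic `Literature/AlgebraicGeometry/Pohlmann1968` (namespace `Literature.AlgebraicGeometry.Pohlmann1968.ExponentFourTimesPrime`); cell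
`pub-hodgecm2` (COR-CM), KEPT Literature lane `lit-deligne-3` gen 64, file F64b-2 (with F64b-1 = the group-theoretic decision of the
index-`4p` kernels, `NumberTheory/ComplexMultiplication/DegenerateCMTypesAbelianKernelsIndexFourMulPrime`, and F64a =
`ExponentTwicePrime`, this completes the lane's «φ(N) = 24» band: the ten cyclotomic fields of degree `24` have `(ℤ/N)ˣ ≅ (ℤ/2)² × ℤ/6`
(`56, 72, 84`: F64a) or `ℤ/2 × ℤ/12` (`35, 39, 45, 52, 70, 78, 90`: this file)).  KERNEL ONLY: theorems; no `def`, no named fact, no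
instance, no notation (D-0014 ∕ D-0026 net debt `0`).  HC_CM is NOT proved here or anywhere in the lane.

## Mathematics

T. Kubota [Kubota1965], §4 LEMMA 2: for a CM field `K` abelian over `ℚ` with group `G ∋ ρ`, the DEFECT `[K:ℚ]/2 + 1 − Rank(Φ)` of a CM
type `Φ` is the number of ODD characters of `G` vanishing on `S = {g : σ_g ∈ Φ}`; grouped by KERNEL (S. P. White's proof of his
Lemma 3; tree `DegenerateCMTypesAbelianKernels.typeRank_add_sum_totient_eq`: `rank(S) + Σ_H φ([G:H]) = |G|/2 + 1` over the admissible
kernels `H` — `ρ ∉ H`, `G/H` cyclic — whose characters vanish).  If `g^{4p} = 1` on `G` then an admissible kernel has index `2`, `4`,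
`2p` or `4p` (`index_eq_of_isCyclic_quotient`: `[G:H]` divides `4p` and is even), and the tree DECIDES all four: index `2` — `S` splits
evenly (`#(S ∩ H) = #(S ∖ H)`; Weil type over the imaginary quadratic `K^H`, Dodson [Dodson1984] §3.1.1); index `4` with cyclic quotient
— `S` meets every coset in half (`2·#(S ∩ gH) = |H|`; `DegenerateCMTypesAbelianKernelsIndexFour`, Yanai's criterion, B. B. Gordon
[Gordon1999HodgeAVSurvey] 9.4.3); index `2p` — `S` EQUIDISTRIBUTED along the `p`-torsion (`#(S ∩ gxH) = #(S ∩ gH)` for `x^p ∈ H`;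
Hazama's Lemma 4.6.1 mechanism [Hazama2003CyclicCM]); index `4p` with cyclic quotient — the same equidistribution (F64b-1,
`…equidistributed_of_index_four_mul`: the `ℚ(i)`-relations among the `p`-th roots of unity).  Hence, EXACTLY,

  `[K:ℚ]/2 + 1 − Rank(Φ) = b(Φ) + 2·e₄(Φ) + (p − 1)·e_{2p}(Φ) + 2(p − 1)·e_{4p}(Φ)`

with — read on the lattice of subfields through the Galois correspondence — `b(Φ) = #{F ⊆ K imaginary quadratic : Φ balanced (Weil type)
over F}`, `e₄(Φ) = #{F ⊆ K : [F:ℚ] = 4, F CM, Gal(F/ℚ) ≅ ℤ/4, every τ : F → ℂ has [K:F]/2 extensions in Φ}`, `e_{2p}(Φ) = #{F ⊆ K :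
[F:ℚ] = 2p, F CM, Φ LEVEL of exponent p over F}` (for every `σ ∈ Gal(F/ℚ)` with `σ^p = 1` and every `τ`, `#{φ ∈ Φ : φ|_F = τ ∘ σ} =
#{φ ∈ Φ : φ|_F = τ}`), `e_{4p}(Φ) = #{F ⊆ K : [F:ℚ] = 4p, F CM, Gal(F/ℚ) CYCLIC, Φ level of exponent p over F}`.  (In exponent `4p` a
subgroup of index `4` or `4p` need not have cyclic quotient — `ℤ/2 × ℤ/2`, `ℤ/2 × ℤ/2p` occur — so the cyclicity clause is part of the
count; the non-cyclic quotients carry no character of that kernel.)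

* §1 GROUP LEVEL (`G` commutative, `g^{4p} = 1`, `ρ`, `T ⊔ ρT = G`): **`index_eq_of_isCyclic_quotient`** (`2 ∨ 4 ∨ 2p ∨ 4p`),
  **`typeRank_add_card_kernels_eq`** (`rank(T) + #B₂ + 2·#B₄ + (p−1)·#B_{2p} + 2(p−1)·#B_{4p} = |G|/2 + 1`), **`typeRank_eq_iff`**
  (nondegenerate iff all four families are empty).
* §2 FIELD LEVEL (`K` CM, `IsAbelianGalois ℚ K`, `g^{4p} = 1` on `Gal(K/ℚ)`): `cmTypeRank_add_card_kernels_eq` (on `Gal`),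
  `card_index_isCyclic_eq_ncard_level` (the equidistributed index-`n` kernels with cyclic quotient ARE the degree-`n` CM subfields with cyclic
  group over which `Φ` is level), **`cmTypeRank_add_ncard_subfields_eq`** (THE INTRINSIC RANK FORMULA displayed above),
  **`isNondegenerate_iff_forall_intermediateField`** (NONDEGENERATE ⟺ Weil type over no imaginary quadratic subfield ∧ halving no cyclic
  quartic CM subfield ∧ level over no CM subfield of degree `2p` ∧ level over no cyclic CM subfield of degree `4p`), and the converses
  `not_isNondegenerate_of_level_of_isCyclic`, `not_isNondegenerate_of_weilQuartic`.
* §3 ABELIAN VARIETIES: for every realisation `(A, ι, θ)` of a type off the four lists, `B•(Aⁿ) ⊗ ℂ = D•(Aⁿ) ⊗ ℂ` for all `n` and the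
  Hodge conjecture for every power (**`hodgeConjectureFor_pow_of_forall_intermediateField`**,
  `hodgeClassSpan_pow_eq_divisorClassesSpan_of_forall_intermediateField`, `not_exists_exceptional_pow_of_forall_intermediateField`) —
  UNCONDITIONAL (Hazama's criterion ∕ Pohlmann, tree `IsNondegenerate.hodgeClassSpan_pow_eq_divisorClassesSpan`).
* §4 CYCLOTOMIC FIELDS `ℚ(ζ_q)` with `u^{4p} = 1` on `(ℤ/q)ˣ` (`cm_abelian_pow_eq_one_of_isCyclotomicExtension` — any exponent `e`,
  `cmTypeRank_add_ncard_subfields_eq_of_isCyclotomicExtension`, `isNondegenerate_iff_of_isCyclotomicExtension`,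
  `hodgeConjectureFor_pow_of_forall_of_isCyclotomicExtension`); the seven levels of `φ(N) = 24` with `(ℤ/N)ˣ ≅ ℤ/2 × ℤ/12`:
  `units_pow_twelve_thirtyFive ∕ … ∕ ninety` (kernel decision on residues), **`cmTypeRank_add_ncard_subfields_thirtyFive`** (`Rank(Φ) + b + 2e₄
  + 2e₆ + 4e₁₂ = 13` for EVERY CM type of `ℚ(ζ₃₅)`), **`hodgeConjectureFor_pow_of_forall_thirtyFive`**, and the same for `39, 45, 52, 70, 78,
  90` (in the level statements `σ ^ 3 = AlgEquiv.refl` spells `σ³ = 1`, keeping instance search off the cyclotomic tower).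
  APPENDED (gen 64, «φ(N) = 40» instances): the levels `55, 75, 100` (`(ℤ/q)ˣ ≅ ℤ/2 × ℤ/20`, `p = 5`, degree `40`):
  `units_pow_twenty_fiftyFive ∕ seventyFive ∕ oneHundred`, **`cmTypeRank_add_ncard_subfields_fiftyFive ∕ seventyFive ∕ oneHundred`**
  (`Rank + b + 2e₄ + 4e₁₀ + 8e₂₀ = 21`), `hodgeConjectureFor_pow_of_forall_fiftyFive ∕ seventyFive ∕ oneHundred`.  Offline census for
  `G = ℤ/2 × ℤ/20 ∋ ρ = (1,0)` (kit job `j338436`, `2²⁰` types; NOT a theorem): PRIMITIVE `1046520` — `(b, e₄, e₁₀, e₂₀) = (0,0,0,0)` rank `21`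
  (NONDEGENERATE): `717480`; `(1,0,0,0)`: `190720`; `(2,0,0,0)`: `59680`; `(0,1,0,0)`: `20480`; `(1,1,0,0)`: `40640`; `(0,0,1,0)`: `3840`;
  `(1,0,1,0)`: `9280`; `(2,0,1,0)`: `2800`; `(1,1,1,0)`: `1360`; `(0,0,2,0)`: `120`; `(0,0,0,1)` rank `13`: `120` — imprimitive `2056`.

NUMERICAL PICTURE (offline census of this seat, NOT a theorem of this file; `lane/census_gen.py 2,12 1,0`): for `G = ℤ/2 × ℤ/12 ∋ ρ = (1,0)`
(`ρ ∉ 2G`, the class of `−1` in `(ℤ/N)ˣ` for all seven levels: `−1` is a non-square mod `N`), `n = 12`, `4096` types, the quadruples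
`(b, e₄, e₆, e₁₂)` and ranks are — PRIMITIVE (`3960` types): `(0,0,0,0)` rank `13` (NONDEGENERATE): `2328`; `(1,0,0,0)` rank `12`: `528`;
`(2,0,0,0)` `11`: `288`; `(0,1,0,0)` `11`: `48`; `(0,0,1,0)` `11`: `192`; `(1,1,0,0)` `10`: `240`; `(1,0,1,0)` `10`: `192`; `(2,0,1,0)` `9`: `48`;
`(0,0,2,0)` `9`: `24`; `(0,0,0,1)` `9`: `24`; `(1,1,1,0)` `8`: `48` — imprimitive (`136` types): `(2,0,2,0)` `7`: `60`; `(0,1,0,1)` `7`: `24`;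
`(1,1,0,1)` `6`: `24`; `(0,0,2,1)` `5`: `8`; `(1,1,1,1)` `4`: `12`; `(2,0,2,1)` `3`: `4`; `(1,1,2,1)` `2`: `4`.  So on `ℚ(ζ₃₅)` all four families
occur on PRIMITIVE types (`24` primitive types are level over a cyclic CM subfield of degree `12`, rank `9`), and §3 covers exactly the
`2328` nondegenerate types (simple CM `12`-folds with `B = D` on all powers).

PRESEARCH (lane rule): the displayed formula was not found in print as such (corpus hybrid + vector; galaxy «degenerate CM type |
degenerate CM-type | nondegenerate CM type», all stars: no statement) — it is Kubota's Lemma 2 regrouped by kernels (White) with Dodson's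
index-`2`, Yanai–Gordon's index-`4`, Hazama's index-`2p` and the lane's index-`4p` vanishing criteria, read through the Galois correspondence;
recorded as the lane's own elementary theorem with those citations.

HONEST REGISTER.  Everything here is unconditional and elementary given the tree's Kubota ∕ Hazama ∕ Pohlmann theorems.  Nothing is claimed
for the DEGENERATE types of these fields: for them `Bᵐ ⊋ Dᵐ` in some degree (Lenstra, tree `AbelianCMField.exists_exceptional_of_oddCharacter`)
and the Hodge conjecture is OPEN in print beyond the Weil-type fourfold ∕ split sixfold cases of Markman; HC_CM is NOT proved and not used.

## References

* [Kubota1965] T. Kubota, *On the field extension by complex multiplication*, Trans. AMS 118 (1965), §4 Lemma 2.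
* [White1993SporadicCycles] S. P. White, *Sporadic cycles on CM abelian varieties*, Compositio Math. 88 (1993), §4, proof of Lemma 3 (p. 131).
* [Dodson1984] B. Dodson, *The structure of Galois groups of CM-fields*, Trans. AMS 283 (1984), §3.1.1 Theorem.
* [Hazama2003CyclicCM] F. Hazama, *Hodge cycles on abelian varieties with complex multiplication by cyclic CM-fields*, J. Math. Sci. Univ.
  Tokyo 10 (2003), Prop. 4.3, Lemma 4.6.1.
* [Gordon1999HodgeAVSurvey] B. B. Gordon, *A survey of the Hodge conjecture for abelian varieties*, 5.13 (ii), Thm. 6.4, §9.3, 9.4.1, 9.4.3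
  (Theorem [B.140] = Yanai 1994).
* [Yanai2015IndexDegeneracy] H. Yanai, *On the index of degeneracy of a CM-type*, Thm. 4.1 (proof, p. 818).
* [MilneFT2022] J. S. Milne, *Fields and Galois Theory*, Thm. 3.16–3.17 (Galois correspondence).
* [Washington1997] L. C. Washington, *Introduction to Cyclotomic Fields*, Ch. 2, Thm. 2.5.
* [Deligne2000] P. Deligne, *The Hodge conjecture* (Clay, 2000), §1.

## Provenance

Cell `pub-hodgecm2` (COR-CM), KEPT Literature lane `lit-deligne-3` gen 64 (claim ABELIAN-EXPONENT-4P-RANK-FORMULA; count-neutral, own lane), file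
F64b-2; neighbours cited by name, nothing restated: `DegenerateCMTypesAbelianKernels{,IndexFour,IndexFourMulPrime}` (group level),
`DegenerateCMTypesAbelianCMFieldCyclicSubfields` (`card_indexTwo_eq_ncard_weilQuadratic`, the kernel ↔ subfield dictionary),
`DegenerateCMTypesAbelianCMFieldCyclicQuarticSubfields` (`card_indexFour_eq_ncard_weilQuartic`), `DegenerateCMTypesAbelianCMFieldExponentTwicePrime`
(`forall_card_filter_eq_iff_level`, `card_index_eq_ncard_level`; the exponent-`2p` model), `NondegenerateCMTypeDivisorClasses`
(`IsNondegenerate.hodgeClassSpan_pow_eq_divisorClassesSpan`).  Theorems only; net Literature debt 0.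
-/

noncomputable section

open scoped BigOperators NumberField IsMulCommutative Classical
open NumberField IntermediateField

namespace Literature.AlgebraicGeometry.Pohlmann1968

namespace ExponentFourTimesPrime

open Literature.NumberTheory.ComplexMultiplication
open Literature.NumberTheory.ComplexMultiplication.CMNumbers
open Literature.AlgebraicGeometry.Motives (CMType)
open Literature.AlgebraicGeometry.Pohlmann1968.CyclicTwoOddPrimes (isCMTypeWith_galType cmTypeRank_eq_typeRank_galType)
open Literature.AlgebraicGeometry.Pohlmann1968.AbelianKernels
open Literature.AlgebraicGeometry.Pohlmann1968.ExponentTwicePrime (forall_card_filter_eq_iff_level card_index_eq_ncard_level)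

/-! ## §0 Arithmetic helper -/

/-- If `a + b + 2c + kd + 2ke = n` with `k ≠ 0` (naturals) then `a = n ↔ b = c = d = e = 0`. [folklore] -/
private theorem eq_iff_of_add_eq₄ₚ {a b c d e k n : ℕ} (hk : k ≠ 0) (h : a + b + 2 * c + k * d + 2 * k * e = n) :
    a = n ↔ b = 0 ∧ c = 0 ∧ d = 0 ∧ e = 0 := by
  set u := k * d with hu
  set v := 2 * k * e with hv
  have hu0 : u = 0 ↔ d = 0 := by rw [hu, Nat.mul_eq_zero]; omega
  have hv0 : v = 0 ↔ e = 0 := by rw [hv, Nat.mul_eq_zero, Nat.mul_eq_zero]; omega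
  constructor
  · intro ha
    exact ⟨by omega, by omega, hu0.1 (by omega), hv0.1 (by omega)⟩
  · rintro ⟨hb, hc, hd, he⟩
    have := hu0.2 hd
    have := hv0.2 he
    omega

/-! ## §1 Group level: in exponent `4p` every admissible kernel has index `2`, `4`, `2p` or `4p` -/

section Group

variable {G : Type*} [CommGroup G] {p : ℕ}

/-- A commutative group of order `2p` (`p` an odd prime) is cyclic. [folklore] -/
private theorem isCyclic_of_card_eq_two_mul₄ₚ [Finite G] [hp : Fact p.Prime] (hp2 : p ≠ 2) (hG : Nat.card G = 2 * p) :
    IsCyclic G := by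
  haveI : Fact (Nat.Prime 2) := ⟨Nat.prime_two⟩
  obtain ⟨x, hx⟩ := exists_prime_orderOf_dvd_card' (G := G) 2 (by rw [hG]; exact dvd_mul_right 2 p)
  obtain ⟨y, hy⟩ := exists_prime_orderOf_dvd_card' (G := G) p (by rw [hG]; exact dvd_mul_left p 2)
  have hcop : Nat.Coprime (orderOf x) (orderOf y) := by
    rw [hx, hy]; exact (Nat.coprime_primes Nat.prime_two hp.out).2 hp2.symm
  exact isCyclic_of_orderOf_eq_card (x * y)
    (by rw [(Commute.all x y).orderOf_mul_eq_mul_orderOf_of_coprime hcop, hx, hy, hG])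

/-- **In a commutative group with `g^{4p} = 1` for all `g` (`p` an odd prime), a subgroup `H` missing an involution `ρ` and
with CYCLIC quotient has index `2`, `4`, `2p` or `4p`**: `|G/H|` divides the exponent `4p` and is even (`ρ̄` has order `2`).
(For index `2p` the quotient is automatically cyclic, `isCyclic_of_card_eq_two_mul₄ₚ`; for index `4` or `4p` it need not be:
`ℤ/2 × ℤ/2`, `ℤ/2 × ℤ/2p`.) [cite: Kubota1965, §4 Lemma 2] [cite: White1993SporadicCycles, §4, proof of Lemma 3 (p. 131)] -/
theorem index_eq_of_isCyclic_quotient [hp : Fact p.Prime] (hp2 : p ≠ 2) (hexp : ∀ g : G, g ^ (4 * p) = 1)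
    {H : Subgroup G} {ρ : G} (hρH : ρ ∉ H) (hρ2 : ρ * ρ = 1) (hcyc : IsCyclic (G ⧸ H)) :
    H.index = 2 ∨ H.index = 4 ∨ H.index = 2 * p ∨ H.index = 4 * p := by
  haveI := hcyc
  have hdvd : H.index ∣ 4 * p := by
    rw [Subgroup.index_eq_card, ← IsCyclic.exponent_eq_card]
    exact Monoid.exponent_dvd_of_forall_pow_eq_one fun q => QuotientGroup.induction_on q fun g => by
      rw [← QuotientGroup.mk_pow, hexp, QuotientGroup.mk_one]
  have hρ1 : (ρ : G ⧸ H) ≠ 1 := fun h => hρH ((QuotientGroup.eq_one_iff ρ).1 h)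
  have hord : orderOf (ρ : G ⧸ H) = 2 := by
    haveI : Fact (Nat.Prime 2) := ⟨Nat.prime_two⟩
    refine orderOf_eq_prime ?_ hρ1
    rw [pow_two, ← QuotientGroup.mk_mul, hρ2, QuotientGroup.mk_one]
  have h2 : 2 ∣ H.index := by rw [Subgroup.index_eq_card, ← hord]; exact orderOf_dvd_natCard _
  have hp2' : ¬ 2 ∣ p := fun h => hp2 ((Nat.prime_dvd_prime_iff_eq Nat.prime_two hp.out).1 h).symm
  obtain ⟨d₁, d₂, hd₁, hd₂, hdeq⟩ := Nat.dvd_mul.1 hdvd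
  have hd₁' : d₁ ∣ 2 ^ 2 := by rw [show (2 : ℕ) ^ 2 = 4 by norm_num]; exact hd₁
  obtain ⟨i, hi, rfl⟩ := (Nat.dvd_prime_pow Nat.prime_two).1 hd₁'
  rcases (Nat.dvd_prime hp.out).1 hd₂ with rfl | rfl
  · interval_cases i
    · exfalso; rw [← hdeq] at h2; norm_num at h2
    · exact Or.inl (by rw [← hdeq, pow_one, mul_one])
    · exact Or.inr (Or.inl (by rw [← hdeq]; norm_num))
  · interval_cases i
    · exfalso; rw [← hdeq, pow_zero, one_mul] at h2; exact hp2' h2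
    · exact Or.inr (Or.inr (Or.inl (by rw [← hdeq, pow_one])))
    · exact Or.inr (Or.inr (Or.inr (by rw [← hdeq]; norm_num)))

variable [Fintype G] [DecidableEq G]

/-- **THE RANK OF A CM TYPE IN EXPONENT `4p` (group level).**  Let `G` be a finite commutative group with `g^{4p} = 1` for all
`g` (`p` an odd prime; `G ≅ (ℤ/2)^r × (ℤ/4)^s × (ℤ/p)^t`), `ρ ∈ G` and `T` a CM type (`T ⊔ ρT = G`).  Then

  `rank(T) + #B₂ + 2·#B₄ + (p − 1)·#B_{2p} + 2(p − 1)·#B_{4p} = |G|/2 + 1`,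

where `B₂` = the index-`2` subgroups `H ∌ ρ` splitting `T` evenly (`#(T ∩ H) = #(T ∖ H)`), `B₄` = the index-`4` subgroups
`H ∌ ρ` with CYCLIC quotient meeting `T` in half of every coset (`2·#(T ∩ gH) = |H|`), `B_{2p}` = the index-`2p` subgroups
`H ∌ ρ` (all with cyclic quotient) at which `T` is EQUIDISTRIBUTED (`#(T ∩ gxH) = #(T ∩ gH)` for all `g` and all `x` with
`x^p ∈ H`), `B_{4p}` = the index-`4p` subgroups `H ∌ ρ` with CYCLIC quotient at which `T` is equidistributed (same condition).
Kubota's defect `Σ_H φ([G:H])` over the admissible kernels (tree `AbelianKernels.typeRank_add_sum_totient_eq`) with the four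
vanishing criteria of the tree: index `2` (`…iff_of_index_two`), `4` (`…iff_of_index_four`), `2p` (`…equidistributed_of_index`),
`4p` (`…equidistributed_of_index_four_mul`); `φ = 1, 2, p − 1, 2(p − 1)`.  The exponent-`2p` case is the neighbour
`ExponentTwicePrime.typeRank_add_card_add_mul_card_eq`, the exponent-`4` case `AbelianKernels.typeRank_add_card_add_two_mul_card_eq`.
[cite: Kubota1965, §4 Lemma 2] [cite: Hazama2003CyclicCM, Prop. 4.3 and Lemma 4.6.1] [cite: Dodson1984, §3.1.1 Theorem]
[cite: Gordon1999HodgeAVSurvey, 9.4.3] -/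
theorem typeRank_add_card_kernels_eq [hp : Fact p.Prime] (hp2 : p ≠ 2) {ρ : G} {T : Finset G}
    (h : IsCMTypeWith ρ (T : Set G)) (hexp : ∀ g : G, g ^ (4 * p) = 1) :
    typeRank G (T : Set G) +
      ((Finset.univ : Finset (Subgroup G)).filter fun H => ρ ∉ H ∧ H.index = 2 ∧
        (T.filter fun s => s ∈ H).card = (T.filter fun s => s ∉ H).card).card +
      2 * ((Finset.univ : Finset (Subgroup G)).filter fun H : Subgroup G => ρ ∉ H ∧ H.index = 4 ∧ IsCyclic (G ⧸ H) ∧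
        ∀ g : G, 2 * ((T.filter fun s => g⁻¹ * s ∈ H).card) = Nat.card H).card +
      (p - 1) * ((Finset.univ : Finset (Subgroup G)).filter fun H => ρ ∉ H ∧ H.index = 2 * p ∧
        ∀ x : G, x ^ p ∈ H → ∀ g : G,
          (T.filter fun s => (g * x)⁻¹ * s ∈ H).card = (T.filter fun s => g⁻¹ * s ∈ H).card).card +
      2 * (p - 1) * ((Finset.univ : Finset (Subgroup G)).filter fun H => ρ ∉ H ∧ H.index = 4 * p ∧ IsCyclic (G ⧸ H) ∧
        ∀ x : G, x ^ p ∈ H → ∀ g : G,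
          (T.filter fun s => (g * x)⁻¹ * s ∈ H).card = (T.filter fun s => g⁻¹ * s ∈ H).card).card =
      Fintype.card G / 2 + 1 := by
  have hρ2 : ρ * ρ = 1 := by simpa [smul_eq_mul] using h.invol (1 : G)
  have hp3 : 3 ≤ p := by
    have := hp.out.two_le
    rcases Nat.lt_or_ge 2 p with h' | h'
    · omega
    · exfalso; exact hp2 (le_antisymm h' this)
  have h2p : Nat.Coprime 2 p := (Nat.coprime_primes Nat.prime_two hp.out).2 hp2.symm
  have h4p : Nat.Coprime 4 p := by rw [show (4 : ℕ) = 2 ^ 2 by norm_num]; exact h2p.pow_left 2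
  have key := CyclicCMType.AbelianKernels.typeRank_add_sum_totient_eq h
  set A := (Finset.univ : Finset (Subgroup G)).filter (fun H => ρ ∉ H ∧ IsCyclic (G ⧸ H) ∧
    ∀ χ : AddChar (Additive G) ℂ, (∀ g : G, χ (Additive.ofMul g) = 1 ↔ g ∈ H) →
      ∑ s ∈ T, χ (Additive.ofMul s) = 0) with hA
  set B₂ := ((Finset.univ : Finset (Subgroup G)).filter fun H => ρ ∉ H ∧ H.index = 2 ∧
        (T.filter fun s => s ∈ H).card = (T.filter fun s => s ∉ H).card) with hB₂
  set B₄ := ((Finset.univ : Finset (Subgroup G)).filter fun H : Subgroup G => ρ ∉ H ∧ H.index = 4 ∧ IsCyclic (G ⧸ H) ∧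
        ∀ g : G, 2 * ((T.filter fun s => g⁻¹ * s ∈ H).card) = Nat.card H) with hB₄
  set B' := ((Finset.univ : Finset (Subgroup G)).filter fun H => ρ ∉ H ∧ H.index = 2 * p ∧
        ∀ x : G, x ^ p ∈ H → ∀ g : G,
          (T.filter fun s => (g * x)⁻¹ * s ∈ H).card = (T.filter fun s => g⁻¹ * s ∈ H).card) with hB'
  set B'' := ((Finset.univ : Finset (Subgroup G)).filter fun H => ρ ∉ H ∧ H.index = 4 * p ∧ IsCyclic (G ⧸ H) ∧
        ∀ x : G, x ^ p ∈ H → ∀ g : G,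
          (T.filter fun s => (g * x)⁻¹ * s ∈ H).card = (T.filter fun s => g⁻¹ * s ∈ H).card) with hB''
  -- the admissible kernels of index `2`
  have hA₂ : A.filter (fun H => H.index = 2) = B₂ := by
    rw [hA, hB₂, Finset.filter_filter]
    refine Finset.filter_congr fun H _ => ?_
    constructor
    · rintro ⟨⟨hρH, -, hchar⟩, hidx⟩
      exact ⟨hρH, hidx,
        (CyclicCMType.AbelianKernels.forall_sum_char_eq_zero_iff_of_index_two hρ2 hρH hidx T).1 hchar⟩
    · rintro ⟨hρH, hidx, hsplit⟩
      haveI : Fact (Nat.Prime 2) := ⟨Nat.prime_two⟩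
      exact ⟨⟨hρH, isCyclic_of_prime_card (p := 2) (by rw [← Subgroup.index_eq_card, hidx]),
        (CyclicCMType.AbelianKernels.forall_sum_char_eq_zero_iff_of_index_two hρ2 hρH hidx T).2 hsplit⟩, hidx⟩
  -- the admissible kernels of index `4`
  have hA₄ : A.filter (fun H => H.index = 4) = B₄ := by
    rw [hA, hB₄, Finset.filter_filter]
    refine Finset.filter_congr fun H _ => ?_
    constructor
    · rintro ⟨⟨hρH, hcyc, hchar⟩, hidx⟩
      exact ⟨hρH, hidx, hcyc,
        (CyclicCMType.AbelianKernels.forall_sum_char_eq_zero_iff_of_index_four h hρH hidx hcyc).1 hchar⟩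
    · rintro ⟨hρH, hidx, hcyc, hhalf⟩
      exact ⟨⟨hρH, hcyc,
        (CyclicCMType.AbelianKernels.forall_sum_char_eq_zero_iff_of_index_four h hρH hidx hcyc).2 hhalf⟩, hidx⟩
  -- the admissible kernels of index `2p`
  have hA' : A.filter (fun H => H.index = 2 * p) = B' := by
    rw [hA, hB', Finset.filter_filter]
    refine Finset.filter_congr fun H _ => ?_
    constructor
    · rintro ⟨⟨hρH, hcyc, hchar⟩, hidx⟩
      have hidx'' : H.index = 2 * p ^ (0 + 1) := by rw [zero_add, pow_one]; exact hidx
      exact ⟨hρH, hidx, (CyclicCMType.AbelianKernels.forall_sum_char_eq_zero_iff_equidistributed_of_index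
        hp2 h hρH hcyc hidx'').1 hchar⟩
    · rintro ⟨hρH, hidx, hE⟩
      have hcyc : IsCyclic (G ⧸ H) :=
        isCyclic_of_card_eq_two_mul₄ₚ hp2 (by rw [← Subgroup.index_eq_card, hidx])
      have hidx'' : H.index = 2 * p ^ (0 + 1) := by rw [zero_add, pow_one]; exact hidx
      exact ⟨⟨hρH, hcyc, (CyclicCMType.AbelianKernels.forall_sum_char_eq_zero_iff_equidistributed_of_index
        hp2 h hρH hcyc hidx'').2 hE⟩, hidx⟩
  -- the admissible kernels of index `4p`
  have hA'' : A.filter (fun H => H.index = 4 * p) = B'' := by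
    rw [hA, hB'', Finset.filter_filter]
    refine Finset.filter_congr fun H _ => ?_
    constructor
    · rintro ⟨⟨hρH, hcyc, hchar⟩, hidx⟩
      exact ⟨hρH, hidx, hcyc, (CyclicCMType.AbelianKernels.forall_sum_char_eq_zero_iff_equidistributed_of_index_four_mul
        hp2 h hρH hcyc hidx).1 hchar⟩
    · rintro ⟨hρH, hidx, hcyc, hE⟩
      exact ⟨⟨hρH, hcyc, (CyclicCMType.AbelianKernels.forall_sum_char_eq_zero_iff_equidistributed_of_index_four_mul
        hp2 h hρH hcyc hidx).2 hE⟩, hidx⟩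
  -- Euler's `φ` on the admissible kernels, pointwise
  have hpt : ∀ H ∈ A, H.index.totient =
      (if H.index = 2 then 1 else 0) + 2 * (if H.index = 4 then 1 else 0) +
        (p - 1) * (if H.index = 2 * p then 1 else 0) + 2 * (p - 1) * (if H.index = 4 * p then 1 else 0) := by
    intro H hH
    rw [hA, Finset.mem_filter] at hH
    obtain ⟨-, hρH, hcyc, -⟩ := hH
    have ht4 : Nat.totient 4 = 2 := by decide
    rcases index_eq_of_isCyclic_quotient hp2 hexp hρH hρ2 hcyc with hi | hi | hi | hi <;> rw [hi]
    · rw [if_pos rfl, if_neg (by omega : (2 : ℕ) ≠ 4), if_neg (by omega : (2 : ℕ) ≠ 2 * p),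
        if_neg (by omega : (2 : ℕ) ≠ 4 * p), Nat.totient_two]
      simp
    · rw [if_neg (by omega : (4 : ℕ) ≠ 2), if_pos rfl, if_neg (by omega : (4 : ℕ) ≠ 2 * p),
        if_neg (by omega : (4 : ℕ) ≠ 4 * p), ht4]
      simp
    · rw [if_neg (by omega : 2 * p ≠ 2), if_neg (by omega : 2 * p ≠ 4), if_pos rfl,
        if_neg (by omega : 2 * p ≠ 4 * p), Nat.totient_mul h2p, Nat.totient_two, Nat.totient_prime hp.out]
      simp
    · rw [if_neg (by omega : 4 * p ≠ 2), if_neg (by omega : 4 * p ≠ 4), if_neg (by omega : 4 * p ≠ 2 * p), if_pos rfl,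
        Nat.totient_mul h4p, ht4, Nat.totient_prime hp.out]
      simp
  have hsum : ∑ H ∈ A, H.index.totient = B₂.card + 2 * B₄.card + (p - 1) * B'.card + 2 * (p - 1) * B''.card := by
    rw [Finset.sum_congr rfl hpt, Finset.sum_add_distrib, Finset.sum_add_distrib, Finset.sum_add_distrib,
      ← Finset.mul_sum, ← Finset.mul_sum, ← Finset.mul_sum, ← Finset.card_filter, ← Finset.card_filter,
      ← Finset.card_filter, ← Finset.card_filter, hA₂, hA₄, hA', hA'']
  have e : typeRank G (T : Set G) + B₂.card + 2 * B₄.card + (p - 1) * B'.card + 2 * (p - 1) * B''.card =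
      typeRank G (T : Set G) + ∑ H ∈ A, H.index.totient := by
    rw [hsum]; ring
  rw [e]
  exact key

/-- **NONDEGENERATE iff `B₂ = B₄ = B_{2p} = B_{4p} = ∅`** (exponent `4p`): no index-`2` subgroup `H ∌ ρ` splits the type evenly,
no index-`4` subgroup `H ∌ ρ` with cyclic quotient is met in half of every coset, and the type is equidistributed at no subgroup
`H ∌ ρ` of index `2p`, nor of index `4p` with cyclic quotient. [cite: Kubota1965, §4 Lemma 2] [cite: Hazama2003CyclicCM, Prop. 4.3]
[cite: Dodson1984, §3.1.1 Theorem] [cite: Gordon1999HodgeAVSurvey, 9.4.3] -/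
theorem typeRank_eq_iff [hp : Fact p.Prime] (hp2 : p ≠ 2) {ρ : G} {T : Finset G}
    (h : IsCMTypeWith ρ (T : Set G)) (hexp : ∀ g : G, g ^ (4 * p) = 1) :
    typeRank G (T : Set G) = Fintype.card G / 2 + 1 ↔
      (∀ H : Subgroup G, ρ ∉ H → H.index = 2 →
          (T.filter fun s => s ∈ H).card ≠ (T.filter fun s => s ∉ H).card) ∧
      (∀ H : Subgroup G, ρ ∉ H → H.index = 4 → IsCyclic (G ⧸ H) →
          ¬ ∀ g : G, 2 * ((T.filter fun s => g⁻¹ * s ∈ H).card) = Nat.card H) ∧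
      (∀ H : Subgroup G, ρ ∉ H → H.index = 2 * p →
          ¬ ∀ x : G, x ^ p ∈ H → ∀ g : G,
            (T.filter fun s => (g * x)⁻¹ * s ∈ H).card = (T.filter fun s => g⁻¹ * s ∈ H).card) ∧
      (∀ H : Subgroup G, ρ ∉ H → H.index = 4 * p → IsCyclic (G ⧸ H) →
          ¬ ∀ x : G, x ^ p ∈ H → ∀ g : G,
            (T.filter fun s => (g * x)⁻¹ * s ∈ H).card = (T.filter fun s => g⁻¹ * s ∈ H).card) := by
  have hp1 : p - 1 ≠ 0 := by have := hp.out.two_le; omega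
  rw [eq_iff_of_add_eq₄ₚ hp1 (typeRank_add_card_kernels_eq hp2 h hexp), Finset.card_eq_zero, Finset.card_eq_zero,
    Finset.card_eq_zero, Finset.card_eq_zero, Finset.filter_eq_empty_iff, Finset.filter_eq_empty_iff,
    Finset.filter_eq_empty_iff, Finset.filter_eq_empty_iff]
  simp only [Finset.mem_univ, forall_true_left, not_and, ne_eq]

end Group

/-! ## §2 Abelian CM fields with Galois group of exponent `4p`: the defect is `b + 2e₄ + (p − 1)·e_{2p} + 2(p − 1)·e_{4p}` -/

section Field

variable {K : Type} [Field K] [NumberField K] [IsCMField K] [IsAbelianGalois ℚ K] {p : ℕ}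

/-- **The defect on `Gal(K/ℚ)` for an abelian CM field of exponent `4p`** (`S = {g : σ_g ∈ Φ}`, `σ_g = φ₀ ∘ g⁻¹`, `ρ` = complex
conjugation): `Rank(Φ) + #B₂ + 2·#B₄ + (p − 1)·#B_{2p} + 2(p − 1)·#B_{4p} = [K:ℚ]/2 + 1` with the four families of
`typeRank_add_card_kernels_eq` read on the subgroups of `Gal(K/ℚ)`. [cite: Kubota1965, §4 Lemma 2] [cite: Hazama2003CyclicCM, Prop. 4.3]
[cite: Dodson1984, §3.1.1 Theorem] [cite: Gordon1999HodgeAVSurvey, 9.4.3] -/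
theorem cmTypeRank_add_card_kernels_eq [Fact p.Prime] (hp2 : p ≠ 2) (φ₀ : K →+* ℂ)
    (hexp : ∀ g : K ≃ₐ[ℚ] K, g ^ (4 * p) = 1) (Φ : CMType K) :
    cmTypeRank Φ +
      ((Finset.univ : Finset (Subgroup (K ≃ₐ[ℚ] K))).filter fun H =>
        (conjGal : K ≃ₐ[ℚ] K) ∉ H ∧ H.index = 2 ∧
        ((Finset.univ.filter fun g : K ≃ₐ[ℚ] K => embOf φ₀ g ∈ Φ.1).filter fun s => s ∈ H).card =
          ((Finset.univ.filter fun g : K ≃ₐ[ℚ] K => embOf φ₀ g ∈ Φ.1).filter fun s => s ∉ H).card).card +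
      2 * ((Finset.univ : Finset (Subgroup (K ≃ₐ[ℚ] K))).filter fun H : Subgroup (K ≃ₐ[ℚ] K) =>
        (conjGal : K ≃ₐ[ℚ] K) ∉ H ∧ H.index = 4 ∧ IsCyclic ((K ≃ₐ[ℚ] K) ⧸ H) ∧
        ∀ g : K ≃ₐ[ℚ] K, 2 * (((Finset.univ.filter fun g : K ≃ₐ[ℚ] K => embOf φ₀ g ∈ Φ.1).filter
          fun s => g⁻¹ * s ∈ H).card) = Nat.card H).card +
      (p - 1) * ((Finset.univ : Finset (Subgroup (K ≃ₐ[ℚ] K))).filter fun H =>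
        (conjGal : K ≃ₐ[ℚ] K) ∉ H ∧ H.index = 2 * p ∧
        ∀ x : K ≃ₐ[ℚ] K, x ^ p ∈ H → ∀ g : K ≃ₐ[ℚ] K,
          ((Finset.univ.filter fun g : K ≃ₐ[ℚ] K => embOf φ₀ g ∈ Φ.1).filter fun s => (g * x)⁻¹ * s ∈ H).card =
          ((Finset.univ.filter fun g : K ≃ₐ[ℚ] K => embOf φ₀ g ∈ Φ.1).filter fun s => g⁻¹ * s ∈ H).card).card +
      2 * (p - 1) * ((Finset.univ : Finset (Subgroup (K ≃ₐ[ℚ] K))).filter fun H =>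
        (conjGal : K ≃ₐ[ℚ] K) ∉ H ∧ H.index = 4 * p ∧ IsCyclic ((K ≃ₐ[ℚ] K) ⧸ H) ∧
        ∀ x : K ≃ₐ[ℚ] K, x ^ p ∈ H → ∀ g : K ≃ₐ[ℚ] K,
          ((Finset.univ.filter fun g : K ≃ₐ[ℚ] K => embOf φ₀ g ∈ Φ.1).filter fun s => (g * x)⁻¹ * s ∈ H).card =
          ((Finset.univ.filter fun g : K ≃ₐ[ℚ] K => embOf φ₀ g ∈ Φ.1).filter fun s => g⁻¹ * s ∈ H).card).card =
      Module.finrank ℚ K / 2 + 1 := by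
  rw [cmTypeRank_eq_typeRank_galType Φ φ₀, ← card_gal_eq_finrank φ₀]
  exact typeRank_add_card_kernels_eq hp2 (isCMTypeWith_galType (AbelianCMFieldExistence.apply_conjGal_eq φ₀) Φ) hexp

/-- **The equidistributed kernels of index `n` WITH CYCLIC QUOTIENT are the CM subfields of degree `n` with CYCLIC Galois group
over which `Φ` is level of exponent `p`**: `H ↦ K^H` (Galois correspondence; `G/H ≅ Gal(K^H/ℚ)`; equidistribution at `Gal(K/F)`
is levelness over `F`, the neighbour's `forall_card_filter_eq_iff_level`).  The version without the cyclicity clause is the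
neighbour's `card_index_eq_ncard_level`. [cite: Yanai2015IndexDegeneracy, Thm. 4.1 (proof, p. 818)] [cite: MilneFT2022, Thm. 3.16] -/
theorem card_index_isCyclic_eq_ncard_level (φ₀ : K →+* ℂ) (Φ : CMType K) (n : ℕ) :
    ((Finset.univ : Finset (Subgroup (K ≃ₐ[ℚ] K))).filter fun H =>
        (conjGal : K ≃ₐ[ℚ] K) ∉ H ∧ H.index = n ∧ IsCyclic ((K ≃ₐ[ℚ] K) ⧸ H) ∧
        ∀ x : K ≃ₐ[ℚ] K, x ^ p ∈ H → ∀ g : K ≃ₐ[ℚ] K,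
          ((Finset.univ.filter fun g : K ≃ₐ[ℚ] K => embOf φ₀ g ∈ Φ.1).filter fun s => (g * x)⁻¹ * s ∈ H).card =
          ((Finset.univ.filter fun g : K ≃ₐ[ℚ] K => embOf φ₀ g ∈ Φ.1).filter fun s => g⁻¹ * s ∈ H).card).card =
      {F : IntermediateField ℚ K | Module.finrank ℚ F = n ∧ ¬ IsTotallyReal F ∧ IsCyclic (F ≃ₐ[ℚ] F) ∧
        ∀ σ : F ≃ₐ[ℚ] F, σ ^ p = 1 → ∀ τ : F →+* ℂ,
          {φ : K →+* ℂ | φ.comp (algebraMap F K) = τ.comp σ.toRingEquiv.toRingHom ∧ φ ∈ Φ.1}.ncard =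
            {φ : K →+* ℂ | φ.comp (algebraMap F K) = τ ∧ φ ∈ Φ.1}.ncard}.ncard := by
  set B := (Finset.univ : Finset (Subgroup (K ≃ₐ[ℚ] K))).filter (fun H =>
    (conjGal : K ≃ₐ[ℚ] K) ∉ H ∧ H.index = n ∧ IsCyclic ((K ≃ₐ[ℚ] K) ⧸ H) ∧
    ∀ x : K ≃ₐ[ℚ] K, x ^ p ∈ H → ∀ g : K ≃ₐ[ℚ] K,
      ((Finset.univ.filter fun g : K ≃ₐ[ℚ] K => embOf φ₀ g ∈ Φ.1).filter fun s => (g * x)⁻¹ * s ∈ H).card =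
      ((Finset.univ.filter fun g : K ≃ₐ[ℚ] K => embOf φ₀ g ∈ Φ.1).filter fun s => g⁻¹ * s ∈ H).card) with hB
  have hinj : Function.Injective (fun H : Subgroup (K ≃ₐ[ℚ] K) => fixedField H) := fun H H' hHH' => by
    have := congrArg IntermediateField.fixingSubgroup hHH'
    simpa only [fixingSubgroup_fixedField] using this
  have himage : (fun H : Subgroup (K ≃ₐ[ℚ] K) => fixedField H) '' (↑B : Set (Subgroup (K ≃ₐ[ℚ] K))) =
      {F : IntermediateField ℚ K | Module.finrank ℚ F = n ∧ ¬ IsTotallyReal F ∧ IsCyclic (F ≃ₐ[ℚ] F) ∧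
        ∀ σ : F ≃ₐ[ℚ] F, σ ^ p = 1 → ∀ τ : F →+* ℂ,
          {φ : K →+* ℂ | φ.comp (algebraMap F K) = τ.comp σ.toRingEquiv.toRingHom ∧ φ ∈ Φ.1}.ncard =
            {φ : K →+* ℂ | φ.comp (algebraMap F K) = τ ∧ φ ∈ Φ.1}.ncard} := by
    ext F
    simp only [Set.mem_image, Finset.mem_coe, hB, Finset.mem_filter, Finset.mem_univ, true_and,
      Set.mem_setOf_eq]
    constructor
    · rintro ⟨H, ⟨hρH, hidx, hcyc, hE⟩, rfl⟩
      refine ⟨by rw [← index_eq_finrank_fixedField, hidx],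
        (conjGal_not_mem_iff_not_isTotallyReal_fixedField H).1 hρH,
        (isCyclic_quotient_iff_isCyclic_gal_fixedField H).1 hcyc,
        (forall_card_filter_eq_iff_level φ₀ Φ (fixedField H)).1 ?_⟩
      simpa only [fixingSubgroup_fixedField] using hE
    · rintro ⟨hn, hF, hcyc, hL⟩
      refine ⟨F.fixingSubgroup, ⟨(conjGal_not_mem_fixingSubgroup_iff F).2 hF,
        by rw [CMNumbers.index_fixingSubgroup_eq_finrank, hn], (isCyclic_quotient_fixingSubgroup_iff F).2 hcyc,
        (forall_card_filter_eq_iff_level φ₀ Φ F).2 hL⟩, IsGalois.fixedField_fixingSubgroup F⟩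
  rw [← himage, Set.ncard_image_of_injective _ hinj, Set.ncard_coe_finset]

/-- **THE RANK OF A CM TYPE OF AN ABELIAN CM FIELD OF EXPONENT `4p`, ON THE LATTICE OF SUBFIELDS.**  Let `K` be a CM field,
abelian over `ℚ`, whose Galois group satisfies `g^{4p} = 1` for all `g` (`Gal(K/ℚ) ≅ (ℤ/2)^r × (ℤ/4)^s × (ℤ/p)^t`, `p` an odd
prime — e.g. `ℚ(ζ₃₅), ℚ(ζ₃₉), ℚ(ζ₄₅), ℚ(ζ₅₂), ℚ(ζ₇₀), ℚ(ζ₇₈), ℚ(ζ₉₀)` (`ℤ/2 × ℤ/12`), `ℚ(ζ₁₀₅), ℚ(ζ₁₄₀), …`, their CM subfields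
and composita with `ℚ(ζ₁₅), ℚ(ζ₁₆), ℚ(ζ₂₀)`), and `Φ` ANY CM type of `K`.  Then

  `Rank(Φ) + b(Φ) + 2·e₄(Φ) + (p − 1)·e_{2p}(Φ) + 2(p − 1)·e_{4p}(Φ) = [K:ℚ]/2 + 1`,

`b(Φ)` = the number of imaginary quadratic subfields over which `Φ` is balanced (Weil type), `e₄(Φ)` = the number of CM subfields
`F` with `Gal(F/ℚ) ≅ ℤ/4` every embedding of which has exactly `[K:F]/2` extensions in `Φ`, `e_{2p}(Φ)` = the number of CM
subfields of degree `2p` (all cyclic) over which `Φ` is LEVEL of exponent `p` (for every `σ ∈ Gal(F/ℚ)` with `σ^p = 1` and every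
`τ : F → ℂ`, `#{φ ∈ Φ : φ|_F = τ ∘ σ} = #{φ ∈ Φ : φ|_F = τ}`), `e_{4p}(Φ)` = the number of CM subfields of degree `4p` with
CYCLIC `Gal(F/ℚ)` over which `Φ` is level of exponent `p`.  Kubota's defect of `Φ` is `b + 2e₄ + (p − 1)e_{2p} + 2(p − 1)e_{4p}`.
[cite: Kubota1965, §4 Lemma 2] [cite: Hazama2003CyclicCM, Prop. 4.3 and Lemma 4.6.1] [cite: Dodson1984, §3.1.1 Theorem]
[cite: Gordon1999HodgeAVSurvey, 5.13 (ii), 9.4.1 and 9.4.3] [cite: Yanai2015IndexDegeneracy, Thm. 4.1 (proof, p. 818)] -/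
theorem cmTypeRank_add_ncard_subfields_eq [Fact p.Prime] (hp2 : p ≠ 2)
    (hexp : ∀ g : K ≃ₐ[ℚ] K, g ^ (4 * p) = 1) (Φ : CMType K) :
    cmTypeRank Φ + {F : IntermediateField ℚ K | Module.finrank ℚ F = 2 ∧ ¬ IsTotallyReal F ∧
        ∀ τ : F →+* ℂ, {φ : K →+* ℂ | φ.comp (algebraMap F K) = τ ∧ φ ∈ Φ.1}.ncard =
          {φ : K →+* ℂ | φ.comp (algebraMap F K) = τ ∧ φ ∉ Φ.1}.ncard}.ncard +
      2 * {F : IntermediateField ℚ K | Module.finrank ℚ F = 4 ∧ ¬ IsTotallyReal F ∧ IsCyclic (F ≃ₐ[ℚ] F) ∧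
        ∀ τ : F →+* ℂ, 2 * {φ : K →+* ℂ | φ.comp (algebraMap F K) = τ ∧ φ ∈ Φ.1}.ncard = Module.finrank F K}.ncard +
      (p - 1) * {F : IntermediateField ℚ K | Module.finrank ℚ F = 2 * p ∧ ¬ IsTotallyReal F ∧
        ∀ σ : F ≃ₐ[ℚ] F, σ ^ p = 1 → ∀ τ : F →+* ℂ,
          {φ : K →+* ℂ | φ.comp (algebraMap F K) = τ.comp σ.toRingEquiv.toRingHom ∧ φ ∈ Φ.1}.ncard =
            {φ : K →+* ℂ | φ.comp (algebraMap F K) = τ ∧ φ ∈ Φ.1}.ncard}.ncard +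
      2 * (p - 1) * {F : IntermediateField ℚ K | Module.finrank ℚ F = 4 * p ∧ ¬ IsTotallyReal F ∧ IsCyclic (F ≃ₐ[ℚ] F) ∧
        ∀ σ : F ≃ₐ[ℚ] F, σ ^ p = 1 → ∀ τ : F →+* ℂ,
          {φ : K →+* ℂ | φ.comp (algebraMap F K) = τ.comp σ.toRingEquiv.toRingHom ∧ φ ∈ Φ.1}.ncard =
            {φ : K →+* ℂ | φ.comp (algebraMap F K) = τ ∧ φ ∈ Φ.1}.ncard}.ncard = Module.finrank ℚ K / 2 + 1 := by
  obtain ⟨φ₀⟩ := (inferInstance : Nonempty (K →+* ℂ))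
  rw [← card_indexTwo_eq_ncard_weilQuadratic φ₀ Φ, ← card_indexFour_eq_ncard_weilQuartic φ₀ Φ,
    ← card_index_eq_ncard_level φ₀ Φ, ← card_index_isCyclic_eq_ncard_level φ₀ Φ (4 * p)]
  exact cmTypeRank_add_card_kernels_eq hp2 φ₀ hexp Φ

omit [IsCMField K] [IsAbelianGalois ℚ K] in
/-- A number field has finitely many subfields (primitive element theorem). [folklore] -/
private theorem finite_intermediateField₄ₚ : Finite (IntermediateField ℚ K) :=
  Field.finite_intermediateField_of_exists_primitive_element ℚ K (Field.exists_primitive_element ℚ K)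

/-- **NONDEGENERACY CRITERION ON THE LATTICE OF SUBFIELDS (exponent `4p`).**  A CM type `Φ` of an abelian CM field `K` with
`g^{4p} = 1` on `Gal(K/ℚ)` is NONDEGENERATE iff (i) `Φ` is balanced over NO imaginary quadratic subfield, (ii) over NO CM subfield
`F` with `Gal(F/ℚ) ≅ ℤ/4` does every embedding have exactly `[K:F]/2` extensions in `Φ`, (iii) `Φ` is level of exponent `p` over NO
CM subfield of degree `2p`, and (iv) over NO CM subfield of degree `4p` with cyclic Galois group — one surviving odd character per
admissible kernel (tree `AbelianKernels.isNondegenerate_iff_forall_exists_ker`), the admissible kernels having index `2, 4, 2p, 4p`.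
[cite: Kubota1965, §4 Lemma 2] [cite: Hazama2003CyclicCM, Prop. 4.3] [cite: Dodson1984, §3.1.1 Theorem] [cite: Gordon1999HodgeAVSurvey, 9.4.3] -/
theorem isNondegenerate_iff_forall_intermediateField [hp : Fact p.Prime] (hp2 : p ≠ 2)
    (hexp : ∀ g : K ≃ₐ[ℚ] K, g ^ (4 * p) = 1) (Φ : CMType K) :
    IsNondegenerate Φ ↔
      (∀ F : IntermediateField ℚ K, Module.finrank ℚ F = 2 → ¬ IsTotallyReal F →
        ¬ ∀ τ : F →+* ℂ, {φ : K →+* ℂ | φ.comp (algebraMap F K) = τ ∧ φ ∈ Φ.1}.ncard =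
          {φ : K →+* ℂ | φ.comp (algebraMap F K) = τ ∧ φ ∉ Φ.1}.ncard) ∧
      (∀ F : IntermediateField ℚ K, Module.finrank ℚ F = 4 → ¬ IsTotallyReal F → IsCyclic (F ≃ₐ[ℚ] F) →
        ¬ ∀ τ : F →+* ℂ, 2 * {φ : K →+* ℂ | φ.comp (algebraMap F K) = τ ∧ φ ∈ Φ.1}.ncard = Module.finrank F K) ∧
      (∀ F : IntermediateField ℚ K, Module.finrank ℚ F = 2 * p → ¬ IsTotallyReal F →
        ¬ ∀ σ : F ≃ₐ[ℚ] F, σ ^ p = 1 → ∀ τ : F →+* ℂ,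
          {φ : K →+* ℂ | φ.comp (algebraMap F K) = τ.comp σ.toRingEquiv.toRingHom ∧ φ ∈ Φ.1}.ncard =
            {φ : K →+* ℂ | φ.comp (algebraMap F K) = τ ∧ φ ∈ Φ.1}.ncard) ∧
      (∀ F : IntermediateField ℚ K, Module.finrank ℚ F = 4 * p → ¬ IsTotallyReal F → IsCyclic (F ≃ₐ[ℚ] F) →
        ¬ ∀ σ : F ≃ₐ[ℚ] F, σ ^ p = 1 → ∀ τ : F →+* ℂ,
          {φ : K →+* ℂ | φ.comp (algebraMap F K) = τ.comp σ.toRingEquiv.toRingHom ∧ φ ∈ Φ.1}.ncard =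
            {φ : K →+* ℂ | φ.comp (algebraMap F K) = τ ∧ φ ∈ Φ.1}.ncard) := by
  haveI := finite_intermediateField₄ₚ (K := K)
  have hp1 : p - 1 ≠ 0 := by have := hp.out.two_le; omega
  rw [_root_.Literature.AlgebraicGeometry.Pohlmann1968.isNondegenerate_iff,
    eq_iff_of_add_eq₄ₚ hp1 (cmTypeRank_add_ncard_subfields_eq hp2 hexp Φ),
    Set.ncard_eq_zero, Set.ncard_eq_zero, Set.ncard_eq_zero, Set.ncard_eq_zero, Set.eq_empty_iff_forall_notMem,
    Set.eq_empty_iff_forall_notMem, Set.eq_empty_iff_forall_notMem, Set.eq_empty_iff_forall_notMem]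
  simp only [Set.mem_setOf_eq, not_and]

/-- **Conversely: a CM subfield of degree `4p` with cyclic Galois group over which `Φ` is level makes the type DEGENERATE** (it
costs `φ(4p) = 2(p − 1)` in rank). [cite: Kubota1965, §4 Lemma 2] [cite: Hazama2003CyclicCM, Prop. 4.3 and Lemma 4.6.1] -/
theorem not_isNondegenerate_of_level_of_isCyclic [Fact p.Prime] (hp2 : p ≠ 2)
    (hexp : ∀ g : K ≃ₐ[ℚ] K, g ^ (4 * p) = 1) (Φ : CMType K) (F : IntermediateField ℚ K)
    (h4p : Module.finrank ℚ F = 4 * p) (hF : ¬ IsTotallyReal F) (hcyc : IsCyclic (F ≃ₐ[ℚ] F))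
    (hlev : ∀ σ : F ≃ₐ[ℚ] F, σ ^ p = 1 → ∀ τ : F →+* ℂ,
      {φ : K →+* ℂ | φ.comp (algebraMap F K) = τ.comp σ.toRingEquiv.toRingHom ∧ φ ∈ Φ.1}.ncard =
        {φ : K →+* ℂ | φ.comp (algebraMap F K) = τ ∧ φ ∈ Φ.1}.ncard) : ¬ IsNondegenerate Φ := by
  rw [isNondegenerate_iff_forall_intermediateField hp2 hexp Φ]
  exact fun h => h.2.2.2 F h4p hF hcyc hlev

/-- **… and so does a CM subfield with `Gal(F/ℚ) ≅ ℤ/4` every embedding of which has `[K:F]/2` extensions in `Φ`** (cost `φ(4) = 2`;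
for ANY abelian CM field this is the neighbour's `cmTypeRank_add_two_le_of_equidistributed`). [cite: Kubota1965, §4 Lemma 2]
[cite: Gordon1999HodgeAVSurvey, 9.4.3 (Theorem [B.140])] -/
theorem not_isNondegenerate_of_weilQuartic [Fact p.Prime] (hp2 : p ≠ 2)
    (hexp : ∀ g : K ≃ₐ[ℚ] K, g ^ (4 * p) = 1) (Φ : CMType K) (F : IntermediateField ℚ K)
    (h4 : Module.finrank ℚ F = 4) (hF : ¬ IsTotallyReal F) (hcyc : IsCyclic (F ≃ₐ[ℚ] F))
    (hW : ∀ τ : F →+* ℂ, 2 * {φ : K →+* ℂ | φ.comp (algebraMap F K) = τ ∧ φ ∈ Φ.1}.ncard = Module.finrank F K) :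
    ¬ IsNondegenerate Φ := by
  rw [isNondegenerate_iff_forall_intermediateField hp2 hexp Φ]
  exact fun h => h.2.1 F h4 hF hcyc hW

end Field

/-! ## §3 Consequences for abelian varieties: `B•(Aⁿ) ⊗ ℂ = D•(Aⁿ) ⊗ ℂ` and the Hodge conjecture for all powers -/

section Varieties

open Literature.AlgebraicGeometry.Motives (AbelianVariety)
open Literature.AlgebraicGeometry.HodgeTheory
open Literature.AlgebraicGeometry.ComplexMultiplication (IsCMTypeRealisation)
open Literature.AlgebraicGeometry.VanGeemen1994 (hodgeClassSpan)
open Literature.Barriers.HodgeConjecture (divisorClassesSpan)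
open _root_.CategoryTheory _root_.CategoryTheory.Limits

variable {K : Type} [Field K] [NumberField K] [IsCMField K] [IsAbelianGalois ℚ K] {p : ℕ}
  {Φ : CMType K} {A : AbelianVariety ℂ} {ι : 𝓞 K →+* End A} {θ : K →+* Module.End ℂ (complexBetti A.X 1)}

/-- `Bᵐ ⊗ ℂ = Dᵐ ⊗ ℂ` for all `m` on an abelian variety gives the Hodge conjecture for it (Lefschetz `(1,1)`, cup products, tree
theorems). [cite: Gordon1999HodgeAVSurvey, §9.3] -/
private theorem hodgeConjectureFor_of_forall_hodgeClassSpan_eq₄ₚ (B : AbelianVariety ℂ)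
    (h : ∀ m : ℕ, hodgeClassSpan B.dim B.X m = divisorClassesSpan B.X B.dim m) : HodgeConjectureFor B.dim B.X :=
  ⟨nonempty_hodgeModel_holds (Motives.AbelianVariety.isSmoothProjective_holds (A := B)),
    fun m _ hc hmm ↦ AbelianVariety.divisorClassesSpan_le_algebraicClasses B
      (fun b hb hb' ↦ lefschetzOneOne_rational_holds (Motives.AbelianVariety.isSmoothProjective_holds (A := B)) b hb hb') m
      ((h m) ▸ Submodule.subset_span ⟨hc, hmm⟩)⟩

/-- **`B•(Aⁿ) ⊗ ℂ = D•(Aⁿ) ⊗ ℂ` FOR EVERY REALISATION OF A TYPE SATISFYING THE CRITERION** (`K` abelian CM of exponent `4p`; `Φ`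
balanced over no imaginary quadratic subfield, halving no cyclic quartic CM subfield, level over no CM subfield of degree `2p` and
over no cyclic CM subfield of degree `4p`): `Φ` is nondegenerate, so for every abelian variety `(A, ι, θ)` of type `(K; Φ)` and all
`n, m` the Hodge classes of `Aⁿ` in degree `2m` are spanned by products of divisor classes (Hazama's criterion ∕ Pohlmann, tree
`IsNondegenerate.hodgeClassSpan_pow_eq_divisorClassesSpan`). [cite: Kubota1965, §4 Lemma 2] [cite: Gordon1999HodgeAVSurvey, Thm. 6.4 and §9.3]
[cite: Hazama2003CyclicCM, Prop. 4.3] -/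
theorem hodgeClassSpan_pow_eq_divisorClassesSpan_of_forall_intermediateField [Fact p.Prime] (hp2 : p ≠ 2)
    (hexp : ∀ g : K ≃ₐ[ℚ] K, g ^ (4 * p) = 1)
    (hW : ∀ F : IntermediateField ℚ K, Module.finrank ℚ F = 2 → ¬ IsTotallyReal F →
        ¬ ∀ τ : F →+* ℂ, {φ : K →+* ℂ | φ.comp (algebraMap F K) = τ ∧ φ ∈ Φ.1}.ncard =
          {φ : K →+* ℂ | φ.comp (algebraMap F K) = τ ∧ φ ∉ Φ.1}.ncard)
    (hQ : ∀ F : IntermediateField ℚ K, Module.finrank ℚ F = 4 → ¬ IsTotallyReal F → IsCyclic (F ≃ₐ[ℚ] F) →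
        ¬ ∀ τ : F →+* ℂ, 2 * {φ : K →+* ℂ | φ.comp (algebraMap F K) = τ ∧ φ ∈ Φ.1}.ncard = Module.finrank F K)
    (hL : ∀ F : IntermediateField ℚ K, Module.finrank ℚ F = 2 * p → ¬ IsTotallyReal F →
        ¬ ∀ σ : F ≃ₐ[ℚ] F, σ ^ p = 1 → ∀ τ : F →+* ℂ,
          {φ : K →+* ℂ | φ.comp (algebraMap F K) = τ.comp σ.toRingEquiv.toRingHom ∧ φ ∈ Φ.1}.ncard =
            {φ : K →+* ℂ | φ.comp (algebraMap F K) = τ ∧ φ ∈ Φ.1}.ncard)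
    (hM : ∀ F : IntermediateField ℚ K, Module.finrank ℚ F = 4 * p → ¬ IsTotallyReal F → IsCyclic (F ≃ₐ[ℚ] F) →
        ¬ ∀ σ : F ≃ₐ[ℚ] F, σ ^ p = 1 → ∀ τ : F →+* ℂ,
          {φ : K →+* ℂ | φ.comp (algebraMap F K) = τ.comp σ.toRingEquiv.toRingHom ∧ φ ∈ Φ.1}.ncard =
            {φ : K →+* ℂ | φ.comp (algebraMap F K) = τ ∧ φ ∈ Φ.1}.ncard)
    (hA : IsCMTypeRealisation Φ A ι θ) (n m : ℕ) :
    hodgeClassSpan (⨁ fun _ : Fin n => A).dim (⨁ fun _ : Fin n => A).X m =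
      divisorClassesSpan (⨁ fun _ : Fin n => A).X (⨁ fun _ : Fin n => A).dim m :=
  ((isNondegenerate_iff_forall_intermediateField hp2 hexp Φ).2 ⟨hW, hQ, hL, hM⟩).hodgeClassSpan_pow_eq_divisorClassesSpan
    hA n m

/-- **THE HODGE CONJECTURE FOR ALL POWERS OF EVERY REALISATION OF A TYPE SATISFYING THE CRITERION** (abelian CM field of exponent
`4p`; no Weil imaginary quadratic subfield, no halved cyclic quartic CM subfield, no level CM subfield of degree `2p`, no level cyclic
CM subfield of degree `4p`) — UNCONDITIONAL, any realisation. [cite: Gordon1999HodgeAVSurvey, Thm. 6.4 and §9.3]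
[cite: Kubota1965, §4 Lemma 2] [cite: Deligne2000, §1] -/
theorem hodgeConjectureFor_pow_of_forall_intermediateField [Fact p.Prime] (hp2 : p ≠ 2)
    (hexp : ∀ g : K ≃ₐ[ℚ] K, g ^ (4 * p) = 1)
    (hW : ∀ F : IntermediateField ℚ K, Module.finrank ℚ F = 2 → ¬ IsTotallyReal F →
        ¬ ∀ τ : F →+* ℂ, {φ : K →+* ℂ | φ.comp (algebraMap F K) = τ ∧ φ ∈ Φ.1}.ncard =
          {φ : K →+* ℂ | φ.comp (algebraMap F K) = τ ∧ φ ∉ Φ.1}.ncard)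
    (hQ : ∀ F : IntermediateField ℚ K, Module.finrank ℚ F = 4 → ¬ IsTotallyReal F → IsCyclic (F ≃ₐ[ℚ] F) →
        ¬ ∀ τ : F →+* ℂ, 2 * {φ : K →+* ℂ | φ.comp (algebraMap F K) = τ ∧ φ ∈ Φ.1}.ncard = Module.finrank F K)
    (hL : ∀ F : IntermediateField ℚ K, Module.finrank ℚ F = 2 * p → ¬ IsTotallyReal F →
        ¬ ∀ σ : F ≃ₐ[ℚ] F, σ ^ p = 1 → ∀ τ : F →+* ℂ,
          {φ : K →+* ℂ | φ.comp (algebraMap F K) = τ.comp σ.toRingEquiv.toRingHom ∧ φ ∈ Φ.1}.ncard =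
            {φ : K →+* ℂ | φ.comp (algebraMap F K) = τ ∧ φ ∈ Φ.1}.ncard)
    (hM : ∀ F : IntermediateField ℚ K, Module.finrank ℚ F = 4 * p → ¬ IsTotallyReal F → IsCyclic (F ≃ₐ[ℚ] F) →
        ¬ ∀ σ : F ≃ₐ[ℚ] F, σ ^ p = 1 → ∀ τ : F →+* ℂ,
          {φ : K →+* ℂ | φ.comp (algebraMap F K) = τ.comp σ.toRingEquiv.toRingHom ∧ φ ∈ Φ.1}.ncard =
            {φ : K →+* ℂ | φ.comp (algebraMap F K) = τ ∧ φ ∈ Φ.1}.ncard)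
    (hA : IsCMTypeRealisation Φ A ι θ) (n : ℕ) :
    HodgeConjectureFor (⨁ fun _ : Fin n => A).dim (⨁ fun _ : Fin n => A).X :=
  hodgeConjectureFor_of_forall_hodgeClassSpan_eq₄ₚ _
    fun m ↦ hodgeClassSpan_pow_eq_divisorClassesSpan_of_forall_intermediateField hp2 hexp hW hQ hL hM hA n m

/-- **No power of such an `A` carries an exceptional Hodge class** (a rational `(m,m)`-class outside `Dᵐ ⊗ ℂ`).
[cite: Gordon1999HodgeAVSurvey, Thm. 6.4] -/
theorem not_exists_exceptional_pow_of_forall_intermediateField [Fact p.Prime] (hp2 : p ≠ 2)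
    (hexp : ∀ g : K ≃ₐ[ℚ] K, g ^ (4 * p) = 1)
    (hW : ∀ F : IntermediateField ℚ K, Module.finrank ℚ F = 2 → ¬ IsTotallyReal F →
        ¬ ∀ τ : F →+* ℂ, {φ : K →+* ℂ | φ.comp (algebraMap F K) = τ ∧ φ ∈ Φ.1}.ncard =
          {φ : K →+* ℂ | φ.comp (algebraMap F K) = τ ∧ φ ∉ Φ.1}.ncard)
    (hQ : ∀ F : IntermediateField ℚ K, Module.finrank ℚ F = 4 → ¬ IsTotallyReal F → IsCyclic (F ≃ₐ[ℚ] F) →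
        ¬ ∀ τ : F →+* ℂ, 2 * {φ : K →+* ℂ | φ.comp (algebraMap F K) = τ ∧ φ ∈ Φ.1}.ncard = Module.finrank F K)
    (hL : ∀ F : IntermediateField ℚ K, Module.finrank ℚ F = 2 * p → ¬ IsTotallyReal F →
        ¬ ∀ σ : F ≃ₐ[ℚ] F, σ ^ p = 1 → ∀ τ : F →+* ℂ,
          {φ : K →+* ℂ | φ.comp (algebraMap F K) = τ.comp σ.toRingEquiv.toRingHom ∧ φ ∈ Φ.1}.ncard =
            {φ : K →+* ℂ | φ.comp (algebraMap F K) = τ ∧ φ ∈ Φ.1}.ncard)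
    (hM : ∀ F : IntermediateField ℚ K, Module.finrank ℚ F = 4 * p → ¬ IsTotallyReal F → IsCyclic (F ≃ₐ[ℚ] F) →
        ¬ ∀ σ : F ≃ₐ[ℚ] F, σ ^ p = 1 → ∀ τ : F →+* ℂ,
          {φ : K →+* ℂ | φ.comp (algebraMap F K) = τ.comp σ.toRingEquiv.toRingHom ∧ φ ∈ Φ.1}.ncard =
            {φ : K →+* ℂ | φ.comp (algebraMap F K) = τ ∧ φ ∈ Φ.1}.ncard)
    (hA : IsCMTypeRealisation Φ A ι θ) (n m : ℕ) :
    ¬ ∃ c : complexBetti (⨁ fun _ : Fin n => A).X (2 * m), IsRationalClass c ∧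
        IsOfHodgeType (⨁ fun _ : Fin n => A).dim (⨁ fun _ : Fin n => A).X (2 * m) m m c ∧
        c ∉ divisorClassesSpan (⨁ fun _ : Fin n => A).X (⨁ fun _ : Fin n => A).dim m := by
  rintro ⟨c, hcQ, hcH, hcD⟩
  exact hcD ((hodgeClassSpan_pow_eq_divisorClassesSpan_of_forall_intermediateField hp2 hexp hW hQ hL hM hA n m) ▸
    Submodule.subset_span ⟨hcQ, hcH⟩)

end Varieties

/-! ## §4 The cyclotomic fields `ℚ(ζ_q)` with `(ℤ/q)ˣ` of exponent `4p`: `q = 35, 39, 45, 52, 70, 78, 90` (`ℤ/2 × ℤ/12`, `φ = 24`) -/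

section Cyclotomic

open Literature.AlgebraicGeometry.Motives (AbelianVariety)
open Literature.AlgebraicGeometry.HodgeTheory
open Literature.AlgebraicGeometry.ComplexMultiplication (IsCMTypeRealisation)
open Literature.AlgebraicGeometry.VanGeemen1994 (hodgeClassSpan)
open Literature.Barriers.HodgeConjecture (divisorClassesSpan)
open _root_.CategoryTheory _root_.CategoryTheory.Limits
open Polynomial

variable {q p : ℕ} {L : Type} [Field L] [NumberField L]
  {Φ : CMType L} {A : AbelianVariety ℂ} {ι : 𝓞 L →+* End A} {θ : L →+* Module.End ℂ (complexBetti A.X 1)}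

/-- For `L ≅ ℚ(ζ_q)` (`q > 2`) with `u^e = 1` for every `u ∈ (ℤ/q)ˣ`: `L` is a CM field, abelian over `ℚ`, with `g^e = 1` for every
`g ∈ Gal(L/ℚ) ≅ (ℤ/q)ˣ`, and `[L:ℚ] = φ(q)` (the neighbour's `ExponentTwicePrime.cm_abelian_pow_eq_one_of_isCyclotomicExtension` is
the case `e = 2p`). [cite: Washington1997, Ch. 2 Thm. 2.5] -/
theorem cm_abelian_pow_eq_one_of_isCyclotomicExtension [NeZero q] (h2q : 2 < q) {e : ℕ} (hq : ∀ u : (ZMod q)ˣ, u ^ e = 1)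
    (L : Type) [Field L] [NumberField L] [IsCyclotomicExtension {q} ℚ L] :
    IsCMField L ∧ IsAbelianGalois ℚ L ∧ (∀ g : L ≃ₐ[ℚ] L, g ^ e = 1) ∧ Module.finrank ℚ L = Nat.totient q := by
  have hirr : Irreducible (cyclotomic q ℚ) := cyclotomic.irreducible_rat (NeZero.pos q)
  refine ⟨IsCyclotomicExtension.Rat.isCMField L (S := ({q} : Set ℕ)) ⟨q, rfl, h2q⟩,
    IsCyclotomicExtension.isAbelianGalois {q} ℚ L, fun g => ?_, IsCyclotomicExtension.finrank L hirr⟩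
  exact (IsCyclotomicExtension.autEquivPow L hirr).injective (by rw [map_pow, hq, map_one])

/-- **The rank formula for `ℚ(ζ_q)`, `(ℤ/q)ˣ` of exponent `4p`**:
`Rank(Φ) + b(Φ) + 2·e₄(Φ) + (p − 1)·e_{2p}(Φ) + 2(p − 1)·e_{4p}(Φ) = φ(q)/2 + 1`. [cite: Kubota1965, §4 Lemma 2]
[cite: Hazama2003CyclicCM, Prop. 4.3] [cite: Dodson1984, §3.1.1 Theorem] [cite: Gordon1999HodgeAVSurvey, 9.4.3] -/
theorem cmTypeRank_add_ncard_subfields_eq_of_isCyclotomicExtension [NeZero q] [IsCyclotomicExtension {q} ℚ L]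
    (h2q : 2 < q) [Fact p.Prime] (hp2 : p ≠ 2) (hq : ∀ u : (ZMod q)ˣ, u ^ (4 * p) = 1) (Φ : CMType L) :
    cmTypeRank Φ + {F : IntermediateField ℚ L | Module.finrank ℚ F = 2 ∧ ¬ IsTotallyReal F ∧
        ∀ τ : F →+* ℂ, {φ : L →+* ℂ | φ.comp (algebraMap F L) = τ ∧ φ ∈ Φ.1}.ncard =
          {φ : L →+* ℂ | φ.comp (algebraMap F L) = τ ∧ φ ∉ Φ.1}.ncard}.ncard +
      2 * {F : IntermediateField ℚ L | Module.finrank ℚ F = 4 ∧ ¬ IsTotallyReal F ∧ IsCyclic (F ≃ₐ[ℚ] F) ∧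
        ∀ τ : F →+* ℂ, 2 * {φ : L →+* ℂ | φ.comp (algebraMap F L) = τ ∧ φ ∈ Φ.1}.ncard = Module.finrank F L}.ncard +
      (p - 1) * {F : IntermediateField ℚ L | Module.finrank ℚ F = 2 * p ∧ ¬ IsTotallyReal F ∧
        ∀ σ : F ≃ₐ[ℚ] F, σ ^ p = 1 → ∀ τ : F →+* ℂ,
          {φ : L →+* ℂ | φ.comp (algebraMap F L) = τ.comp σ.toRingEquiv.toRingHom ∧ φ ∈ Φ.1}.ncard =
            {φ : L →+* ℂ | φ.comp (algebraMap F L) = τ ∧ φ ∈ Φ.1}.ncard}.ncard +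
      2 * (p - 1) * {F : IntermediateField ℚ L | Module.finrank ℚ F = 4 * p ∧ ¬ IsTotallyReal F ∧ IsCyclic (F ≃ₐ[ℚ] F) ∧
        ∀ σ : F ≃ₐ[ℚ] F, σ ^ p = 1 → ∀ τ : F →+* ℂ,
          {φ : L →+* ℂ | φ.comp (algebraMap F L) = τ.comp σ.toRingEquiv.toRingHom ∧ φ ∈ Φ.1}.ncard =
            {φ : L →+* ℂ | φ.comp (algebraMap F L) = τ ∧ φ ∈ Φ.1}.ncard}.ncard = Nat.totient q / 2 + 1 := by
  obtain ⟨hcm, hab, hexp, hL⟩ := cm_abelian_pow_eq_one_of_isCyclotomicExtension h2q hq L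
  haveI := hcm; haveI := hab
  rw [← hL]
  exact cmTypeRank_add_ncard_subfields_eq hp2 hexp Φ

/-- **Nondegeneracy criterion for `ℚ(ζ_q)`, `(ℤ/q)ˣ` of exponent `4p`.** [cite: Kubota1965, §4 Lemma 2] [cite: Hazama2003CyclicCM, Prop. 4.3]
[cite: Dodson1984, §3.1.1 Theorem] [cite: Gordon1999HodgeAVSurvey, 9.4.3] -/
theorem isNondegenerate_iff_of_isCyclotomicExtension [NeZero q] [IsCyclotomicExtension {q} ℚ L]
    (h2q : 2 < q) [Fact p.Prime] (hp2 : p ≠ 2) (hq : ∀ u : (ZMod q)ˣ, u ^ (4 * p) = 1) (Φ : CMType L) :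
    IsNondegenerate Φ ↔
      (∀ F : IntermediateField ℚ L, Module.finrank ℚ F = 2 → ¬ IsTotallyReal F →
        ¬ ∀ τ : F →+* ℂ, {φ : L →+* ℂ | φ.comp (algebraMap F L) = τ ∧ φ ∈ Φ.1}.ncard =
          {φ : L →+* ℂ | φ.comp (algebraMap F L) = τ ∧ φ ∉ Φ.1}.ncard) ∧
      (∀ F : IntermediateField ℚ L, Module.finrank ℚ F = 4 → ¬ IsTotallyReal F → IsCyclic (F ≃ₐ[ℚ] F) →
        ¬ ∀ τ : F →+* ℂ, 2 * {φ : L →+* ℂ | φ.comp (algebraMap F L) = τ ∧ φ ∈ Φ.1}.ncard = Module.finrank F L) ∧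
      (∀ F : IntermediateField ℚ L, Module.finrank ℚ F = 2 * p → ¬ IsTotallyReal F →
        ¬ ∀ σ : F ≃ₐ[ℚ] F, σ ^ p = 1 → ∀ τ : F →+* ℂ,
          {φ : L →+* ℂ | φ.comp (algebraMap F L) = τ.comp σ.toRingEquiv.toRingHom ∧ φ ∈ Φ.1}.ncard =
            {φ : L →+* ℂ | φ.comp (algebraMap F L) = τ ∧ φ ∈ Φ.1}.ncard) ∧
      (∀ F : IntermediateField ℚ L, Module.finrank ℚ F = 4 * p → ¬ IsTotallyReal F → IsCyclic (F ≃ₐ[ℚ] F) →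
        ¬ ∀ σ : F ≃ₐ[ℚ] F, σ ^ p = 1 → ∀ τ : F →+* ℂ,
          {φ : L →+* ℂ | φ.comp (algebraMap F L) = τ.comp σ.toRingEquiv.toRingHom ∧ φ ∈ Φ.1}.ncard =
            {φ : L →+* ℂ | φ.comp (algebraMap F L) = τ ∧ φ ∈ Φ.1}.ncard) := by
  obtain ⟨hcm, hab, hexp, -⟩ := cm_abelian_pow_eq_one_of_isCyclotomicExtension h2q hq L
  haveI := hcm; haveI := hab
  exact isNondegenerate_iff_forall_intermediateField hp2 hexp Φ

/-- **The Hodge conjecture for all powers of every realisation of a type of `ℚ(ζ_q)`** (`(ℤ/q)ˣ` of exponent `4p`) **satisfying the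
four-clause criterion** — UNCONDITIONAL. [cite: Gordon1999HodgeAVSurvey, Thm. 6.4 and §9.3] [cite: Kubota1965, §4 Lemma 2] -/
theorem hodgeConjectureFor_pow_of_forall_of_isCyclotomicExtension [NeZero q] [IsCyclotomicExtension {q} ℚ L]
    (h2q : 2 < q) [Fact p.Prime] (hp2 : p ≠ 2) (hq : ∀ u : (ZMod q)ˣ, u ^ (4 * p) = 1)
    (hW : ∀ F : IntermediateField ℚ L, Module.finrank ℚ F = 2 → ¬ IsTotallyReal F →
        ¬ ∀ τ : F →+* ℂ, {φ : L →+* ℂ | φ.comp (algebraMap F L) = τ ∧ φ ∈ Φ.1}.ncard =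
          {φ : L →+* ℂ | φ.comp (algebraMap F L) = τ ∧ φ ∉ Φ.1}.ncard)
    (hQ : ∀ F : IntermediateField ℚ L, Module.finrank ℚ F = 4 → ¬ IsTotallyReal F → IsCyclic (F ≃ₐ[ℚ] F) →
        ¬ ∀ τ : F →+* ℂ, 2 * {φ : L →+* ℂ | φ.comp (algebraMap F L) = τ ∧ φ ∈ Φ.1}.ncard = Module.finrank F L)
    (hL : ∀ F : IntermediateField ℚ L, Module.finrank ℚ F = 2 * p → ¬ IsTotallyReal F →
        ¬ ∀ σ : F ≃ₐ[ℚ] F, σ ^ p = 1 → ∀ τ : F →+* ℂ,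
          {φ : L →+* ℂ | φ.comp (algebraMap F L) = τ.comp σ.toRingEquiv.toRingHom ∧ φ ∈ Φ.1}.ncard =
            {φ : L →+* ℂ | φ.comp (algebraMap F L) = τ ∧ φ ∈ Φ.1}.ncard)
    (hM : ∀ F : IntermediateField ℚ L, Module.finrank ℚ F = 4 * p → ¬ IsTotallyReal F → IsCyclic (F ≃ₐ[ℚ] F) →
        ¬ ∀ σ : F ≃ₐ[ℚ] F, σ ^ p = 1 → ∀ τ : F →+* ℂ,
          {φ : L →+* ℂ | φ.comp (algebraMap F L) = τ.comp σ.toRingEquiv.toRingHom ∧ φ ∈ Φ.1}.ncard =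
            {φ : L →+* ℂ | φ.comp (algebraMap F L) = τ ∧ φ ∈ Φ.1}.ncard)
    (hA : IsCMTypeRealisation Φ A ι θ) (n : ℕ) :
    HodgeConjectureFor (⨁ fun _ : Fin n => A).dim (⨁ fun _ : Fin n => A).X := by
  obtain ⟨hcm, hab, hexp, -⟩ := cm_abelian_pow_eq_one_of_isCyclotomicExtension h2q hq L
  haveI := hcm; haveI := hab
  exact hodgeConjectureFor_pow_of_forall_intermediateField hp2 hexp hW hQ hL hM hA n

/-! ### The levels `35, 39, 45, 52, 70, 78, 90`: `(ℤ/q)ˣ ≅ ℤ/2 × ℤ/12`, `φ(q) = 24`, `p = 3` -/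

/-- `u¹² = 1` for every unit of `ℤ/35`: `(ℤ/35)ˣ ≅ ℤ/2 × ℤ/12` (kernel decision on the residues coprime to `35`).
[cite: Washington1997, Ch. 2 Thm. 2.5] -/
theorem units_pow_twelve_thirtyFive (u : (ZMod 35)ˣ) : u ^ (4 * 3) = 1 := by
  have h : ∀ a : ZMod 35, Nat.Coprime a.val 35 → a ^ 12 = 1 := by decide
  exact Units.ext (by rw [Units.val_pow_eq_pow_val, h _ (ZMod.val_coe_unit_coprime u), Units.val_one])

/-- **`ℚ(ζ₃₅)` (degree `24`, `Gal ≅ ℤ/2 × ℤ/12`): `Rank(Φ) + b(Φ) + 2·e₄(Φ) + 2·e₆(Φ) + 4·e₁₂(Φ) = 13`** for EVERY CM type `Φ` — `b` =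
the number of imaginary quadratic subfields over which `Φ` is of Weil type, `e₄` = the number of CM subfields `F` with `Gal(F/ℚ) ≅ ℤ/4`
every embedding of which has `[ℚ(ζ₃₅):F]/2 = 3` extensions in `Φ`, `e₆` = the number of (cyclic) sextic CM subfields over which `Φ`
is level of exponent `3`, `e₁₂` = the number of CM subfields of degree `12` with cyclic Galois group over which `Φ` is level of
exponent `3`. [cite: Kubota1965, §4 Lemma 2] [cite: Hazama2003CyclicCM, Prop. 4.3] [cite: Dodson1984, §3.1.1 Theorem]
[cite: Gordon1999HodgeAVSurvey, 9.4.3] -/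
theorem cmTypeRank_add_ncard_subfields_thirtyFive [IsCyclotomicExtension {35} ℚ L] (Φ : CMType L) :
    cmTypeRank Φ + {F : IntermediateField ℚ L | Module.finrank ℚ F = 2 ∧ ¬ IsTotallyReal F ∧
        ∀ τ : F →+* ℂ, {φ : L →+* ℂ | φ.comp (algebraMap F L) = τ ∧ φ ∈ Φ.1}.ncard =
          {φ : L →+* ℂ | φ.comp (algebraMap F L) = τ ∧ φ ∉ Φ.1}.ncard}.ncard +
      2 * {F : IntermediateField ℚ L | Module.finrank ℚ F = 4 ∧ ¬ IsTotallyReal F ∧ IsCyclic (F ≃ₐ[ℚ] F) ∧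
        ∀ τ : F →+* ℂ, 2 * {φ : L →+* ℂ | φ.comp (algebraMap F L) = τ ∧ φ ∈ Φ.1}.ncard = Module.finrank F L}.ncard +
      2 * {F : IntermediateField ℚ L | Module.finrank ℚ F = 6 ∧ ¬ IsTotallyReal F ∧
        ∀ σ : F ≃ₐ[ℚ] F, σ ^ (3 : ℕ) = AlgEquiv.refl → ∀ τ : F →+* ℂ,
          {φ : L →+* ℂ | φ.comp (algebraMap F L) = τ.comp σ.toRingEquiv.toRingHom ∧ φ ∈ Φ.1}.ncard =
            {φ : L →+* ℂ | φ.comp (algebraMap F L) = τ ∧ φ ∈ Φ.1}.ncard}.ncard +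
      4 * {F : IntermediateField ℚ L | Module.finrank ℚ F = 12 ∧ ¬ IsTotallyReal F ∧ IsCyclic (F ≃ₐ[ℚ] F) ∧
        ∀ σ : F ≃ₐ[ℚ] F, σ ^ (3 : ℕ) = AlgEquiv.refl → ∀ τ : F →+* ℂ,
          {φ : L →+* ℂ | φ.comp (algebraMap F L) = τ.comp σ.toRingEquiv.toRingHom ∧ φ ∈ Φ.1}.ncard =
            {φ : L →+* ℂ | φ.comp (algebraMap F L) = τ ∧ φ ∈ Φ.1}.ncard}.ncard = 13 := by
  haveI : Fact (Nat.Prime 3) := ⟨Nat.prime_three⟩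
  have h := cmTypeRank_add_ncard_subfields_eq_of_isCyclotomicExtension (L := L) (q := 35) (by norm_num)
    (by decide : (3 : ℕ) ≠ 2) units_pow_twelve_thirtyFive Φ
  have hφ : Nat.totient 35 = 24 := by decide
  rw [hφ] at h
  exact h

/-- **`ℚ(ζ₃₅)`: THE HODGE CONJECTURE FOR ALL POWERS of every abelian variety with complex multiplication by `ℚ(ζ₃₅)` (CM `12`-folds)
whose type is of Weil type over no imaginary quadratic subfield, halves no cyclic quartic CM subfield, and is level of exponent `3`
over no sextic CM subfield and over no cyclic CM subfield of degree `12`** — UNCONDITIONAL.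
[cite: Gordon1999HodgeAVSurvey, Thm. 6.4 and §9.3] [cite: Kubota1965, §4 Lemma 2] -/
theorem hodgeConjectureFor_pow_of_forall_thirtyFive [IsCyclotomicExtension {35} ℚ L]
    (hW : ∀ F : IntermediateField ℚ L, Module.finrank ℚ F = 2 → ¬ IsTotallyReal F →
        ¬ ∀ τ : F →+* ℂ, {φ : L →+* ℂ | φ.comp (algebraMap F L) = τ ∧ φ ∈ Φ.1}.ncard =
          {φ : L →+* ℂ | φ.comp (algebraMap F L) = τ ∧ φ ∉ Φ.1}.ncard)
    (hQ : ∀ F : IntermediateField ℚ L, Module.finrank ℚ F = 4 → ¬ IsTotallyReal F → IsCyclic (F ≃ₐ[ℚ] F) →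
        ¬ ∀ τ : F →+* ℂ, 2 * {φ : L →+* ℂ | φ.comp (algebraMap F L) = τ ∧ φ ∈ Φ.1}.ncard = Module.finrank F L)
    (hL : ∀ F : IntermediateField ℚ L, Module.finrank ℚ F = 2 * 3 → ¬ IsTotallyReal F →
        ¬ ∀ σ : F ≃ₐ[ℚ] F, σ ^ (3 : ℕ) = AlgEquiv.refl → ∀ τ : F →+* ℂ,
          {φ : L →+* ℂ | φ.comp (algebraMap F L) = τ.comp σ.toRingEquiv.toRingHom ∧ φ ∈ Φ.1}.ncard =
            {φ : L →+* ℂ | φ.comp (algebraMap F L) = τ ∧ φ ∈ Φ.1}.ncard)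
    (hM : ∀ F : IntermediateField ℚ L, Module.finrank ℚ F = 4 * 3 → ¬ IsTotallyReal F → IsCyclic (F ≃ₐ[ℚ] F) →
        ¬ ∀ σ : F ≃ₐ[ℚ] F, σ ^ (3 : ℕ) = AlgEquiv.refl → ∀ τ : F →+* ℂ,
          {φ : L →+* ℂ | φ.comp (algebraMap F L) = τ.comp σ.toRingEquiv.toRingHom ∧ φ ∈ Φ.1}.ncard =
            {φ : L →+* ℂ | φ.comp (algebraMap F L) = τ ∧ φ ∈ Φ.1}.ncard)
    (hA : IsCMTypeRealisation Φ A ι θ) (n : ℕ) :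
    HodgeConjectureFor (⨁ fun _ : Fin n => A).dim (⨁ fun _ : Fin n => A).X :=
  haveI : Fact (Nat.Prime 3) := ⟨Nat.prime_three⟩
  hodgeConjectureFor_pow_of_forall_of_isCyclotomicExtension (q := 35) (by norm_num) (by decide) units_pow_twelve_thirtyFive
    hW hQ hL hM hA n

/-- `u¹² = 1` for every unit of `ℤ/39`: `(ℤ/39)ˣ ≅ ℤ/2 × ℤ/12` (kernel decision on the residues coprime to `39`).
[cite: Washington1997, Ch. 2 Thm. 2.5] -/
theorem units_pow_twelve_thirtyNine (u : (ZMod 39)ˣ) : u ^ (4 * 3) = 1 := by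
  have h : ∀ a : ZMod 39, Nat.Coprime a.val 39 → a ^ 12 = 1 := by decide
  exact Units.ext (by rw [Units.val_pow_eq_pow_val, h _ (ZMod.val_coe_unit_coprime u), Units.val_one])

/-- **`ℚ(ζ₃₉)` (degree `24`, `Gal ≅ ℤ/2 × ℤ/12`): `Rank(Φ) + b(Φ) + 2·e₄(Φ) + 2·e₆(Φ) + 4·e₁₂(Φ) = 13`** for EVERY CM type `Φ` — `b` =
the number of imaginary quadratic subfields over which `Φ` is of Weil type, `e₄` = the number of CM subfields `F` with `Gal(F/ℚ) ≅ ℤ/4`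
every embedding of which has `[ℚ(ζ₃₉):F]/2 = 3` extensions in `Φ`, `e₆` = the number of (cyclic) sextic CM subfields over which `Φ`
is level of exponent `3`, `e₁₂` = the number of CM subfields of degree `12` with cyclic Galois group over which `Φ` is level of
exponent `3`. [cite: Kubota1965, §4 Lemma 2] [cite: Hazama2003CyclicCM, Prop. 4.3] [cite: Dodson1984, §3.1.1 Theorem]
[cite: Gordon1999HodgeAVSurvey, 9.4.3] -/
theorem cmTypeRank_add_ncard_subfields_thirtyNine [IsCyclotomicExtension {39} ℚ L] (Φ : CMType L) :
    cmTypeRank Φ + {F : IntermediateField ℚ L | Module.finrank ℚ F = 2 ∧ ¬ IsTotallyReal F ∧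
        ∀ τ : F →+* ℂ, {φ : L →+* ℂ | φ.comp (algebraMap F L) = τ ∧ φ ∈ Φ.1}.ncard =
          {φ : L →+* ℂ | φ.comp (algebraMap F L) = τ ∧ φ ∉ Φ.1}.ncard}.ncard +
      2 * {F : IntermediateField ℚ L | Module.finrank ℚ F = 4 ∧ ¬ IsTotallyReal F ∧ IsCyclic (F ≃ₐ[ℚ] F) ∧
        ∀ τ : F →+* ℂ, 2 * {φ : L →+* ℂ | φ.comp (algebraMap F L) = τ ∧ φ ∈ Φ.1}.ncard = Module.finrank F L}.ncard +
      2 * {F : IntermediateField ℚ L | Module.finrank ℚ F = 6 ∧ ¬ IsTotallyReal F ∧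
        ∀ σ : F ≃ₐ[ℚ] F, σ ^ (3 : ℕ) = AlgEquiv.refl → ∀ τ : F →+* ℂ,
          {φ : L →+* ℂ | φ.comp (algebraMap F L) = τ.comp σ.toRingEquiv.toRingHom ∧ φ ∈ Φ.1}.ncard =
            {φ : L →+* ℂ | φ.comp (algebraMap F L) = τ ∧ φ ∈ Φ.1}.ncard}.ncard +
      4 * {F : IntermediateField ℚ L | Module.finrank ℚ F = 12 ∧ ¬ IsTotallyReal F ∧ IsCyclic (F ≃ₐ[ℚ] F) ∧
        ∀ σ : F ≃ₐ[ℚ] F, σ ^ (3 : ℕ) = AlgEquiv.refl → ∀ τ : F →+* ℂ,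
          {φ : L →+* ℂ | φ.comp (algebraMap F L) = τ.comp σ.toRingEquiv.toRingHom ∧ φ ∈ Φ.1}.ncard =
            {φ : L →+* ℂ | φ.comp (algebraMap F L) = τ ∧ φ ∈ Φ.1}.ncard}.ncard = 13 := by
  haveI : Fact (Nat.Prime 3) := ⟨Nat.prime_three⟩
  have h := cmTypeRank_add_ncard_subfields_eq_of_isCyclotomicExtension (L := L) (q := 39) (by norm_num)
    (by decide : (3 : ℕ) ≠ 2) units_pow_twelve_thirtyNine Φ
  have hφ : Nat.totient 39 = 24 := by decide
  rw [hφ] at h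
  exact h

/-- **`ℚ(ζ₃₉)`: THE HODGE CONJECTURE FOR ALL POWERS of every abelian variety with complex multiplication by `ℚ(ζ₃₉)` (CM `12`-folds)
whose type is of Weil type over no imaginary quadratic subfield, halves no cyclic quartic CM subfield, and is level of exponent `3`
over no sextic CM subfield and over no cyclic CM subfield of degree `12`** — UNCONDITIONAL.
[cite: Gordon1999HodgeAVSurvey, Thm. 6.4 and §9.3] [cite: Kubota1965, §4 Lemma 2] -/
theorem hodgeConjectureFor_pow_of_forall_thirtyNine [IsCyclotomicExtension {39} ℚ L]
    (hW : ∀ F : IntermediateField ℚ L, Module.finrank ℚ F = 2 → ¬ IsTotallyReal F →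
        ¬ ∀ τ : F →+* ℂ, {φ : L →+* ℂ | φ.comp (algebraMap F L) = τ ∧ φ ∈ Φ.1}.ncard =
          {φ : L →+* ℂ | φ.comp (algebraMap F L) = τ ∧ φ ∉ Φ.1}.ncard)
    (hQ : ∀ F : IntermediateField ℚ L, Module.finrank ℚ F = 4 → ¬ IsTotallyReal F → IsCyclic (F ≃ₐ[ℚ] F) →
        ¬ ∀ τ : F →+* ℂ, 2 * {φ : L →+* ℂ | φ.comp (algebraMap F L) = τ ∧ φ ∈ Φ.1}.ncard = Module.finrank F L)
    (hL : ∀ F : IntermediateField ℚ L, Module.finrank ℚ F = 2 * 3 → ¬ IsTotallyReal F →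
        ¬ ∀ σ : F ≃ₐ[ℚ] F, σ ^ (3 : ℕ) = AlgEquiv.refl → ∀ τ : F →+* ℂ,
          {φ : L →+* ℂ | φ.comp (algebraMap F L) = τ.comp σ.toRingEquiv.toRingHom ∧ φ ∈ Φ.1}.ncard =
            {φ : L →+* ℂ | φ.comp (algebraMap F L) = τ ∧ φ ∈ Φ.1}.ncard)
    (hM : ∀ F : IntermediateField ℚ L, Module.finrank ℚ F = 4 * 3 → ¬ IsTotallyReal F → IsCyclic (F ≃ₐ[ℚ] F) →
        ¬ ∀ σ : F ≃ₐ[ℚ] F, σ ^ (3 : ℕ) = AlgEquiv.refl → ∀ τ : F →+* ℂ,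
          {φ : L →+* ℂ | φ.comp (algebraMap F L) = τ.comp σ.toRingEquiv.toRingHom ∧ φ ∈ Φ.1}.ncard =
            {φ : L →+* ℂ | φ.comp (algebraMap F L) = τ ∧ φ ∈ Φ.1}.ncard)
    (hA : IsCMTypeRealisation Φ A ι θ) (n : ℕ) :
    HodgeConjectureFor (⨁ fun _ : Fin n => A).dim (⨁ fun _ : Fin n => A).X :=
  haveI : Fact (Nat.Prime 3) := ⟨Nat.prime_three⟩
  hodgeConjectureFor_pow_of_forall_of_isCyclotomicExtension (q := 39) (by norm_num) (by decide) units_pow_twelve_thirtyNine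
    hW hQ hL hM hA n

/-- `u¹² = 1` for every unit of `ℤ/45`: `(ℤ/45)ˣ ≅ ℤ/2 × ℤ/12` (kernel decision on the residues coprime to `45`).
[cite: Washington1997, Ch. 2 Thm. 2.5] -/
theorem units_pow_twelve_fortyFive (u : (ZMod 45)ˣ) : u ^ (4 * 3) = 1 := by
  have h : ∀ a : ZMod 45, Nat.Coprime a.val 45 → a ^ 12 = 1 := by decide
  exact Units.ext (by rw [Units.val_pow_eq_pow_val, h _ (ZMod.val_coe_unit_coprime u), Units.val_one])

/-- **`ℚ(ζ₄₅)` (degree `24`, `Gal ≅ ℤ/2 × ℤ/12`): `Rank(Φ) + b(Φ) + 2·e₄(Φ) + 2·e₆(Φ) + 4·e₁₂(Φ) = 13`** for EVERY CM type `Φ` — `b` =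
the number of imaginary quadratic subfields over which `Φ` is of Weil type, `e₄` = the number of CM subfields `F` with `Gal(F/ℚ) ≅ ℤ/4`
every embedding of which has `[ℚ(ζ₄₅):F]/2 = 3` extensions in `Φ`, `e₆` = the number of (cyclic) sextic CM subfields over which `Φ`
is level of exponent `3`, `e₁₂` = the number of CM subfields of degree `12` with cyclic Galois group over which `Φ` is level of
exponent `3`. [cite: Kubota1965, §4 Lemma 2] [cite: Hazama2003CyclicCM, Prop. 4.3] [cite: Dodson1984, §3.1.1 Theorem]
[cite: Gordon1999HodgeAVSurvey, 9.4.3] -/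
theorem cmTypeRank_add_ncard_subfields_fortyFive [IsCyclotomicExtension {45} ℚ L] (Φ : CMType L) :
    cmTypeRank Φ + {F : IntermediateField ℚ L | Module.finrank ℚ F = 2 ∧ ¬ IsTotallyReal F ∧
        ∀ τ : F →+* ℂ, {φ : L →+* ℂ | φ.comp (algebraMap F L) = τ ∧ φ ∈ Φ.1}.ncard =
          {φ : L →+* ℂ | φ.comp (algebraMap F L) = τ ∧ φ ∉ Φ.1}.ncard}.ncard +
      2 * {F : IntermediateField ℚ L | Module.finrank ℚ F = 4 ∧ ¬ IsTotallyReal F ∧ IsCyclic (F ≃ₐ[ℚ] F) ∧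
        ∀ τ : F →+* ℂ, 2 * {φ : L →+* ℂ | φ.comp (algebraMap F L) = τ ∧ φ ∈ Φ.1}.ncard = Module.finrank F L}.ncard +
      2 * {F : IntermediateField ℚ L | Module.finrank ℚ F = 6 ∧ ¬ IsTotallyReal F ∧
        ∀ σ : F ≃ₐ[ℚ] F, σ ^ (3 : ℕ) = AlgEquiv.refl → ∀ τ : F →+* ℂ,
          {φ : L →+* ℂ | φ.comp (algebraMap F L) = τ.comp σ.toRingEquiv.toRingHom ∧ φ ∈ Φ.1}.ncard =
            {φ : L →+* ℂ | φ.comp (algebraMap F L) = τ ∧ φ ∈ Φ.1}.ncard}.ncard +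
      4 * {F : IntermediateField ℚ L | Module.finrank ℚ F = 12 ∧ ¬ IsTotallyReal F ∧ IsCyclic (F ≃ₐ[ℚ] F) ∧
        ∀ σ : F ≃ₐ[ℚ] F, σ ^ (3 : ℕ) = AlgEquiv.refl → ∀ τ : F →+* ℂ,
          {φ : L →+* ℂ | φ.comp (algebraMap F L) = τ.comp σ.toRingEquiv.toRingHom ∧ φ ∈ Φ.1}.ncard =
            {φ : L →+* ℂ | φ.comp (algebraMap F L) = τ ∧ φ ∈ Φ.1}.ncard}.ncard = 13 := by
  haveI : Fact (Nat.Prime 3) := ⟨Nat.prime_three⟩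
  have h := cmTypeRank_add_ncard_subfields_eq_of_isCyclotomicExtension (L := L) (q := 45) (by norm_num)
    (by decide : (3 : ℕ) ≠ 2) units_pow_twelve_fortyFive Φ
  have hφ : Nat.totient 45 = 24 := by decide
  rw [hφ] at h
  exact h

/-- **`ℚ(ζ₄₅)`: THE HODGE CONJECTURE FOR ALL POWERS of every abelian variety with complex multiplication by `ℚ(ζ₄₅)` (CM `12`-folds)
whose type is of Weil type over no imaginary quadratic subfield, halves no cyclic quartic CM subfield, and is level of exponent `3`
over no sextic CM subfield and over no cyclic CM subfield of degree `12`** — UNCONDITIONAL.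
[cite: Gordon1999HodgeAVSurvey, Thm. 6.4 and §9.3] [cite: Kubota1965, §4 Lemma 2] -/
theorem hodgeConjectureFor_pow_of_forall_fortyFive [IsCyclotomicExtension {45} ℚ L]
    (hW : ∀ F : IntermediateField ℚ L, Module.finrank ℚ F = 2 → ¬ IsTotallyReal F →
        ¬ ∀ τ : F →+* ℂ, {φ : L →+* ℂ | φ.comp (algebraMap F L) = τ ∧ φ ∈ Φ.1}.ncard =
          {φ : L →+* ℂ | φ.comp (algebraMap F L) = τ ∧ φ ∉ Φ.1}.ncard)
    (hQ : ∀ F : IntermediateField ℚ L, Module.finrank ℚ F = 4 → ¬ IsTotallyReal F → IsCyclic (F ≃ₐ[ℚ] F) →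
        ¬ ∀ τ : F →+* ℂ, 2 * {φ : L →+* ℂ | φ.comp (algebraMap F L) = τ ∧ φ ∈ Φ.1}.ncard = Module.finrank F L)
    (hL : ∀ F : IntermediateField ℚ L, Module.finrank ℚ F = 2 * 3 → ¬ IsTotallyReal F →
        ¬ ∀ σ : F ≃ₐ[ℚ] F, σ ^ (3 : ℕ) = AlgEquiv.refl → ∀ τ : F →+* ℂ,
          {φ : L →+* ℂ | φ.comp (algebraMap F L) = τ.comp σ.toRingEquiv.toRingHom ∧ φ ∈ Φ.1}.ncard =
            {φ : L →+* ℂ | φ.comp (algebraMap F L) = τ ∧ φ ∈ Φ.1}.ncard)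
    (hM : ∀ F : IntermediateField ℚ L, Module.finrank ℚ F = 4 * 3 → ¬ IsTotallyReal F → IsCyclic (F ≃ₐ[ℚ] F) →
        ¬ ∀ σ : F ≃ₐ[ℚ] F, σ ^ (3 : ℕ) = AlgEquiv.refl → ∀ τ : F →+* ℂ,
          {φ : L →+* ℂ | φ.comp (algebraMap F L) = τ.comp σ.toRingEquiv.toRingHom ∧ φ ∈ Φ.1}.ncard =
            {φ : L →+* ℂ | φ.comp (algebraMap F L) = τ ∧ φ ∈ Φ.1}.ncard)
    (hA : IsCMTypeRealisation Φ A ι θ) (n : ℕ) :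
    HodgeConjectureFor (⨁ fun _ : Fin n => A).dim (⨁ fun _ : Fin n => A).X :=
  haveI : Fact (Nat.Prime 3) := ⟨Nat.prime_three⟩
  hodgeConjectureFor_pow_of_forall_of_isCyclotomicExtension (q := 45) (by norm_num) (by decide) units_pow_twelve_fortyFive
    hW hQ hL hM hA n

/-- `u¹² = 1` for every unit of `ℤ/52`: `(ℤ/52)ˣ ≅ ℤ/2 × ℤ/12` (kernel decision on the residues coprime to `52`).
[cite: Washington1997, Ch. 2 Thm. 2.5] -/
theorem units_pow_twelve_fiftyTwo (u : (ZMod 52)ˣ) : u ^ (4 * 3) = 1 := by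
  have h : ∀ a : ZMod 52, Nat.Coprime a.val 52 → a ^ 12 = 1 := by decide
  exact Units.ext (by rw [Units.val_pow_eq_pow_val, h _ (ZMod.val_coe_unit_coprime u), Units.val_one])

/-- **`ℚ(ζ₅₂)` (degree `24`, `Gal ≅ ℤ/2 × ℤ/12`): `Rank(Φ) + b(Φ) + 2·e₄(Φ) + 2·e₆(Φ) + 4·e₁₂(Φ) = 13`** for EVERY CM type `Φ` — `b` =
the number of imaginary quadratic subfields over which `Φ` is of Weil type, `e₄` = the number of CM subfields `F` with `Gal(F/ℚ) ≅ ℤ/4`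
every embedding of which has `[ℚ(ζ₅₂):F]/2 = 3` extensions in `Φ`, `e₆` = the number of (cyclic) sextic CM subfields over which `Φ`
is level of exponent `3`, `e₁₂` = the number of CM subfields of degree `12` with cyclic Galois group over which `Φ` is level of
exponent `3`. [cite: Kubota1965, §4 Lemma 2] [cite: Hazama2003CyclicCM, Prop. 4.3] [cite: Dodson1984, §3.1.1 Theorem]
[cite: Gordon1999HodgeAVSurvey, 9.4.3] -/
theorem cmTypeRank_add_ncard_subfields_fiftyTwo [IsCyclotomicExtension {52} ℚ L] (Φ : CMType L) :
    cmTypeRank Φ + {F : IntermediateField ℚ L | Module.finrank ℚ F = 2 ∧ ¬ IsTotallyReal F ∧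
        ∀ τ : F →+* ℂ, {φ : L →+* ℂ | φ.comp (algebraMap F L) = τ ∧ φ ∈ Φ.1}.ncard =
          {φ : L →+* ℂ | φ.comp (algebraMap F L) = τ ∧ φ ∉ Φ.1}.ncard}.ncard +
      2 * {F : IntermediateField ℚ L | Module.finrank ℚ F = 4 ∧ ¬ IsTotallyReal F ∧ IsCyclic (F ≃ₐ[ℚ] F) ∧
        ∀ τ : F →+* ℂ, 2 * {φ : L →+* ℂ | φ.comp (algebraMap F L) = τ ∧ φ ∈ Φ.1}.ncard = Module.finrank F L}.ncard +
      2 * {F : IntermediateField ℚ L | Module.finrank ℚ F = 6 ∧ ¬ IsTotallyReal F ∧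
        ∀ σ : F ≃ₐ[ℚ] F, σ ^ (3 : ℕ) = AlgEquiv.refl → ∀ τ : F →+* ℂ,
          {φ : L →+* ℂ | φ.comp (algebraMap F L) = τ.comp σ.toRingEquiv.toRingHom ∧ φ ∈ Φ.1}.ncard =
            {φ : L →+* ℂ | φ.comp (algebraMap F L) = τ ∧ φ ∈ Φ.1}.ncard}.ncard +
      4 * {F : IntermediateField ℚ L | Module.finrank ℚ F = 12 ∧ ¬ IsTotallyReal F ∧ IsCyclic (F ≃ₐ[ℚ] F) ∧
        ∀ σ : F ≃ₐ[ℚ] F, σ ^ (3 : ℕ) = AlgEquiv.refl → ∀ τ : F →+* ℂ,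
          {φ : L →+* ℂ | φ.comp (algebraMap F L) = τ.comp σ.toRingEquiv.toRingHom ∧ φ ∈ Φ.1}.ncard =
            {φ : L →+* ℂ | φ.comp (algebraMap F L) = τ ∧ φ ∈ Φ.1}.ncard}.ncard = 13 := by
  haveI : Fact (Nat.Prime 3) := ⟨Nat.prime_three⟩
  have h := cmTypeRank_add_ncard_subfields_eq_of_isCyclotomicExtension (L := L) (q := 52) (by norm_num)
    (by decide : (3 : ℕ) ≠ 2) units_pow_twelve_fiftyTwo Φ
  have hφ : Nat.totient 52 = 24 := by decide
  rw [hφ] at h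
  exact h

/-- **`ℚ(ζ₅₂)`: THE HODGE CONJECTURE FOR ALL POWERS of every abelian variety with complex multiplication by `ℚ(ζ₅₂)` (CM `12`-folds)
whose type is of Weil type over no imaginary quadratic subfield, halves no cyclic quartic CM subfield, and is level of exponent `3`
over no sextic CM subfield and over no cyclic CM subfield of degree `12`** — UNCONDITIONAL.
[cite: Gordon1999HodgeAVSurvey, Thm. 6.4 and §9.3] [cite: Kubota1965, §4 Lemma 2] -/
theorem hodgeConjectureFor_pow_of_forall_fiftyTwo [IsCyclotomicExtension {52} ℚ L]
    (hW : ∀ F : IntermediateField ℚ L, Module.finrank ℚ F = 2 → ¬ IsTotallyReal F →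
        ¬ ∀ τ : F →+* ℂ, {φ : L →+* ℂ | φ.comp (algebraMap F L) = τ ∧ φ ∈ Φ.1}.ncard =
          {φ : L →+* ℂ | φ.comp (algebraMap F L) = τ ∧ φ ∉ Φ.1}.ncard)
    (hQ : ∀ F : IntermediateField ℚ L, Module.finrank ℚ F = 4 → ¬ IsTotallyReal F → IsCyclic (F ≃ₐ[ℚ] F) →
        ¬ ∀ τ : F →+* ℂ, 2 * {φ : L →+* ℂ | φ.comp (algebraMap F L) = τ ∧ φ ∈ Φ.1}.ncard = Module.finrank F L)
    (hL : ∀ F : IntermediateField ℚ L, Module.finrank ℚ F = 2 * 3 → ¬ IsTotallyReal F →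
        ¬ ∀ σ : F ≃ₐ[ℚ] F, σ ^ (3 : ℕ) = AlgEquiv.refl → ∀ τ : F →+* ℂ,
          {φ : L →+* ℂ | φ.comp (algebraMap F L) = τ.comp σ.toRingEquiv.toRingHom ∧ φ ∈ Φ.1}.ncard =
            {φ : L →+* ℂ | φ.comp (algebraMap F L) = τ ∧ φ ∈ Φ.1}.ncard)
    (hM : ∀ F : IntermediateField ℚ L, Module.finrank ℚ F = 4 * 3 → ¬ IsTotallyReal F → IsCyclic (F ≃ₐ[ℚ] F) →
        ¬ ∀ σ : F ≃ₐ[ℚ] F, σ ^ (3 : ℕ) = AlgEquiv.refl → ∀ τ : F →+* ℂ,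
          {φ : L →+* ℂ | φ.comp (algebraMap F L) = τ.comp σ.toRingEquiv.toRingHom ∧ φ ∈ Φ.1}.ncard =
            {φ : L →+* ℂ | φ.comp (algebraMap F L) = τ ∧ φ ∈ Φ.1}.ncard)
    (hA : IsCMTypeRealisation Φ A ι θ) (n : ℕ) :
    HodgeConjectureFor (⨁ fun _ : Fin n => A).dim (⨁ fun _ : Fin n => A).X :=
  haveI : Fact (Nat.Prime 3) := ⟨Nat.prime_three⟩
  hodgeConjectureFor_pow_of_forall_of_isCyclotomicExtension (q := 52) (by norm_num) (by decide) units_pow_twelve_fiftyTwo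
    hW hQ hL hM hA n

/-- `u¹² = 1` for every unit of `ℤ/70`: `(ℤ/70)ˣ ≅ ℤ/2 × ℤ/12` (kernel decision on the residues coprime to `70`).
[cite: Washington1997, Ch. 2 Thm. 2.5] -/
theorem units_pow_twelve_seventy (u : (ZMod 70)ˣ) : u ^ (4 * 3) = 1 := by
  have h : ∀ a : ZMod 70, Nat.Coprime a.val 70 → a ^ 12 = 1 := by decide
  exact Units.ext (by rw [Units.val_pow_eq_pow_val, h _ (ZMod.val_coe_unit_coprime u), Units.val_one])

/-- **`ℚ(ζ₇₀)` (degree `24`, `Gal ≅ ℤ/2 × ℤ/12`): `Rank(Φ) + b(Φ) + 2·e₄(Φ) + 2·e₆(Φ) + 4·e₁₂(Φ) = 13`** for EVERY CM type `Φ` — `b` =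
the number of imaginary quadratic subfields over which `Φ` is of Weil type, `e₄` = the number of CM subfields `F` with `Gal(F/ℚ) ≅ ℤ/4`
every embedding of which has `[ℚ(ζ₇₀):F]/2 = 3` extensions in `Φ`, `e₆` = the number of (cyclic) sextic CM subfields over which `Φ`
is level of exponent `3`, `e₁₂` = the number of CM subfields of degree `12` with cyclic Galois group over which `Φ` is level of
exponent `3`. [cite: Kubota1965, §4 Lemma 2] [cite: Hazama2003CyclicCM, Prop. 4.3] [cite: Dodson1984, §3.1.1 Theorem]
[cite: Gordon1999HodgeAVSurvey, 9.4.3] -/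
theorem cmTypeRank_add_ncard_subfields_seventy [IsCyclotomicExtension {70} ℚ L] (Φ : CMType L) :
    cmTypeRank Φ + {F : IntermediateField ℚ L | Module.finrank ℚ F = 2 ∧ ¬ IsTotallyReal F ∧
        ∀ τ : F →+* ℂ, {φ : L →+* ℂ | φ.comp (algebraMap F L) = τ ∧ φ ∈ Φ.1}.ncard =
          {φ : L →+* ℂ | φ.comp (algebraMap F L) = τ ∧ φ ∉ Φ.1}.ncard}.ncard +
      2 * {F : IntermediateField ℚ L | Module.finrank ℚ F = 4 ∧ ¬ IsTotallyReal F ∧ IsCyclic (F ≃ₐ[ℚ] F) ∧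
        ∀ τ : F →+* ℂ, 2 * {φ : L →+* ℂ | φ.comp (algebraMap F L) = τ ∧ φ ∈ Φ.1}.ncard = Module.finrank F L}.ncard +
      2 * {F : IntermediateField ℚ L | Module.finrank ℚ F = 6 ∧ ¬ IsTotallyReal F ∧
        ∀ σ : F ≃ₐ[ℚ] F, σ ^ (3 : ℕ) = AlgEquiv.refl → ∀ τ : F →+* ℂ,
          {φ : L →+* ℂ | φ.comp (algebraMap F L) = τ.comp σ.toRingEquiv.toRingHom ∧ φ ∈ Φ.1}.ncard =
            {φ : L →+* ℂ | φ.comp (algebraMap F L) = τ ∧ φ ∈ Φ.1}.ncard}.ncard +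
      4 * {F : IntermediateField ℚ L | Module.finrank ℚ F = 12 ∧ ¬ IsTotallyReal F ∧ IsCyclic (F ≃ₐ[ℚ] F) ∧
        ∀ σ : F ≃ₐ[ℚ] F, σ ^ (3 : ℕ) = AlgEquiv.refl → ∀ τ : F →+* ℂ,
          {φ : L →+* ℂ | φ.comp (algebraMap F L) = τ.comp σ.toRingEquiv.toRingHom ∧ φ ∈ Φ.1}.ncard =
            {φ : L →+* ℂ | φ.comp (algebraMap F L) = τ ∧ φ ∈ Φ.1}.ncard}.ncard = 13 := by
  haveI : Fact (Nat.Prime 3) := ⟨Nat.prime_three⟩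
  have h := cmTypeRank_add_ncard_subfields_eq_of_isCyclotomicExtension (L := L) (q := 70) (by norm_num)
    (by decide : (3 : ℕ) ≠ 2) units_pow_twelve_seventy Φ
  have hφ : Nat.totient 70 = 24 := by decide
  rw [hφ] at h
  exact h

/-- **`ℚ(ζ₇₀)`: THE HODGE CONJECTURE FOR ALL POWERS of every abelian variety with complex multiplication by `ℚ(ζ₇₀)` (CM `12`-folds)
whose type is of Weil type over no imaginary quadratic subfield, halves no cyclic quartic CM subfield, and is level of exponent `3`
over no sextic CM subfield and over no cyclic CM subfield of degree `12`** — UNCONDITIONAL.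
[cite: Gordon1999HodgeAVSurvey, Thm. 6.4 and §9.3] [cite: Kubota1965, §4 Lemma 2] -/
theorem hodgeConjectureFor_pow_of_forall_seventy [IsCyclotomicExtension {70} ℚ L]
    (hW : ∀ F : IntermediateField ℚ L, Module.finrank ℚ F = 2 → ¬ IsTotallyReal F →
        ¬ ∀ τ : F →+* ℂ, {φ : L →+* ℂ | φ.comp (algebraMap F L) = τ ∧ φ ∈ Φ.1}.ncard =
          {φ : L →+* ℂ | φ.comp (algebraMap F L) = τ ∧ φ ∉ Φ.1}.ncard)
    (hQ : ∀ F : IntermediateField ℚ L, Module.finrank ℚ F = 4 → ¬ IsTotallyReal F → IsCyclic (F ≃ₐ[ℚ] F) →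
        ¬ ∀ τ : F →+* ℂ, 2 * {φ : L →+* ℂ | φ.comp (algebraMap F L) = τ ∧ φ ∈ Φ.1}.ncard = Module.finrank F L)
    (hL : ∀ F : IntermediateField ℚ L, Module.finrank ℚ F = 2 * 3 → ¬ IsTotallyReal F →
        ¬ ∀ σ : F ≃ₐ[ℚ] F, σ ^ (3 : ℕ) = AlgEquiv.refl → ∀ τ : F →+* ℂ,
          {φ : L →+* ℂ | φ.comp (algebraMap F L) = τ.comp σ.toRingEquiv.toRingHom ∧ φ ∈ Φ.1}.ncard =
            {φ : L →+* ℂ | φ.comp (algebraMap F L) = τ ∧ φ ∈ Φ.1}.ncard)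
    (hM : ∀ F : IntermediateField ℚ L, Module.finrank ℚ F = 4 * 3 → ¬ IsTotallyReal F → IsCyclic (F ≃ₐ[ℚ] F) →
        ¬ ∀ σ : F ≃ₐ[ℚ] F, σ ^ (3 : ℕ) = AlgEquiv.refl → ∀ τ : F →+* ℂ,
          {φ : L →+* ℂ | φ.comp (algebraMap F L) = τ.comp σ.toRingEquiv.toRingHom ∧ φ ∈ Φ.1}.ncard =
            {φ : L →+* ℂ | φ.comp (algebraMap F L) = τ ∧ φ ∈ Φ.1}.ncard)
    (hA : IsCMTypeRealisation Φ A ι θ) (n : ℕ) :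
    HodgeConjectureFor (⨁ fun _ : Fin n => A).dim (⨁ fun _ : Fin n => A).X :=
  haveI : Fact (Nat.Prime 3) := ⟨Nat.prime_three⟩
  hodgeConjectureFor_pow_of_forall_of_isCyclotomicExtension (q := 70) (by norm_num) (by decide) units_pow_twelve_seventy
    hW hQ hL hM hA n

/-- `u¹² = 1` for every unit of `ℤ/78`: `(ℤ/78)ˣ ≅ ℤ/2 × ℤ/12` (kernel decision on the residues coprime to `78`).
[cite: Washington1997, Ch. 2 Thm. 2.5] -/
theorem units_pow_twelve_seventyEight (u : (ZMod 78)ˣ) : u ^ (4 * 3) = 1 := by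
  have h : ∀ a : ZMod 78, Nat.Coprime a.val 78 → a ^ 12 = 1 := by decide
  exact Units.ext (by rw [Units.val_pow_eq_pow_val, h _ (ZMod.val_coe_unit_coprime u), Units.val_one])

/-- **`ℚ(ζ₇₈)` (degree `24`, `Gal ≅ ℤ/2 × ℤ/12`): `Rank(Φ) + b(Φ) + 2·e₄(Φ) + 2·e₆(Φ) + 4·e₁₂(Φ) = 13`** for EVERY CM type `Φ` — `b` =
the number of imaginary quadratic subfields over which `Φ` is of Weil type, `e₄` = the number of CM subfields `F` with `Gal(F/ℚ) ≅ ℤ/4`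
every embedding of which has `[ℚ(ζ₇₈):F]/2 = 3` extensions in `Φ`, `e₆` = the number of (cyclic) sextic CM subfields over which `Φ`
is level of exponent `3`, `e₁₂` = the number of CM subfields of degree `12` with cyclic Galois group over which `Φ` is level of
exponent `3`. [cite: Kubota1965, §4 Lemma 2] [cite: Hazama2003CyclicCM, Prop. 4.3] [cite: Dodson1984, §3.1.1 Theorem]
[cite: Gordon1999HodgeAVSurvey, 9.4.3] -/
theorem cmTypeRank_add_ncard_subfields_seventyEight [IsCyclotomicExtension {78} ℚ L] (Φ : CMType L) :
    cmTypeRank Φ + {F : IntermediateField ℚ L | Module.finrank ℚ F = 2 ∧ ¬ IsTotallyReal F ∧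
        ∀ τ : F →+* ℂ, {φ : L →+* ℂ | φ.comp (algebraMap F L) = τ ∧ φ ∈ Φ.1}.ncard =
          {φ : L →+* ℂ | φ.comp (algebraMap F L) = τ ∧ φ ∉ Φ.1}.ncard}.ncard +
      2 * {F : IntermediateField ℚ L | Module.finrank ℚ F = 4 ∧ ¬ IsTotallyReal F ∧ IsCyclic (F ≃ₐ[ℚ] F) ∧
        ∀ τ : F →+* ℂ, 2 * {φ : L →+* ℂ | φ.comp (algebraMap F L) = τ ∧ φ ∈ Φ.1}.ncard = Module.finrank F L}.ncard +
      2 * {F : IntermediateField ℚ L | Module.finrank ℚ F = 6 ∧ ¬ IsTotallyReal F ∧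
        ∀ σ : F ≃ₐ[ℚ] F, σ ^ (3 : ℕ) = AlgEquiv.refl → ∀ τ : F →+* ℂ,
          {φ : L →+* ℂ | φ.comp (algebraMap F L) = τ.comp σ.toRingEquiv.toRingHom ∧ φ ∈ Φ.1}.ncard =
            {φ : L →+* ℂ | φ.comp (algebraMap F L) = τ ∧ φ ∈ Φ.1}.ncard}.ncard +
      4 * {F : IntermediateField ℚ L | Module.finrank ℚ F = 12 ∧ ¬ IsTotallyReal F ∧ IsCyclic (F ≃ₐ[ℚ] F) ∧
        ∀ σ : F ≃ₐ[ℚ] F, σ ^ (3 : ℕ) = AlgEquiv.refl → ∀ τ : F →+* ℂ,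
          {φ : L →+* ℂ | φ.comp (algebraMap F L) = τ.comp σ.toRingEquiv.toRingHom ∧ φ ∈ Φ.1}.ncard =
            {φ : L →+* ℂ | φ.comp (algebraMap F L) = τ ∧ φ ∈ Φ.1}.ncard}.ncard = 13 := by
  haveI : Fact (Nat.Prime 3) := ⟨Nat.prime_three⟩
  have h := cmTypeRank_add_ncard_subfields_eq_of_isCyclotomicExtension (L := L) (q := 78) (by norm_num)
    (by decide : (3 : ℕ) ≠ 2) units_pow_twelve_seventyEight Φ
  have hφ : Nat.totient 78 = 24 := by decide
  rw [hφ] at h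
  exact h

/-- **`ℚ(ζ₇₈)`: THE HODGE CONJECTURE FOR ALL POWERS of every abelian variety with complex multiplication by `ℚ(ζ₇₈)` (CM `12`-folds)
whose type is of Weil type over no imaginary quadratic subfield, halves no cyclic quartic CM subfield, and is level of exponent `3`
over no sextic CM subfield and over no cyclic CM subfield of degree `12`** — UNCONDITIONAL.
[cite: Gordon1999HodgeAVSurvey, Thm. 6.4 and §9.3] [cite: Kubota1965, §4 Lemma 2] -/
theorem hodgeConjectureFor_pow_of_forall_seventyEight [IsCyclotomicExtension {78} ℚ L]
    (hW : ∀ F : IntermediateField ℚ L, Module.finrank ℚ F = 2 → ¬ IsTotallyReal F →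
        ¬ ∀ τ : F →+* ℂ, {φ : L →+* ℂ | φ.comp (algebraMap F L) = τ ∧ φ ∈ Φ.1}.ncard =
          {φ : L →+* ℂ | φ.comp (algebraMap F L) = τ ∧ φ ∉ Φ.1}.ncard)
    (hQ : ∀ F : IntermediateField ℚ L, Module.finrank ℚ F = 4 → ¬ IsTotallyReal F → IsCyclic (F ≃ₐ[ℚ] F) →
        ¬ ∀ τ : F →+* ℂ, 2 * {φ : L →+* ℂ | φ.comp (algebraMap F L) = τ ∧ φ ∈ Φ.1}.ncard = Module.finrank F L)
    (hL : ∀ F : IntermediateField ℚ L, Module.finrank ℚ F = 2 * 3 → ¬ IsTotallyReal F →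
        ¬ ∀ σ : F ≃ₐ[ℚ] F, σ ^ (3 : ℕ) = AlgEquiv.refl → ∀ τ : F →+* ℂ,
          {φ : L →+* ℂ | φ.comp (algebraMap F L) = τ.comp σ.toRingEquiv.toRingHom ∧ φ ∈ Φ.1}.ncard =
            {φ : L →+* ℂ | φ.comp (algebraMap F L) = τ ∧ φ ∈ Φ.1}.ncard)
    (hM : ∀ F : IntermediateField ℚ L, Module.finrank ℚ F = 4 * 3 → ¬ IsTotallyReal F → IsCyclic (F ≃ₐ[ℚ] F) →
        ¬ ∀ σ : F ≃ₐ[ℚ] F, σ ^ (3 : ℕ) = AlgEquiv.refl → ∀ τ : F →+* ℂ,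
          {φ : L →+* ℂ | φ.comp (algebraMap F L) = τ.comp σ.toRingEquiv.toRingHom ∧ φ ∈ Φ.1}.ncard =
            {φ : L →+* ℂ | φ.comp (algebraMap F L) = τ ∧ φ ∈ Φ.1}.ncard)
    (hA : IsCMTypeRealisation Φ A ι θ) (n : ℕ) :
    HodgeConjectureFor (⨁ fun _ : Fin n => A).dim (⨁ fun _ : Fin n => A).X :=
  haveI : Fact (Nat.Prime 3) := ⟨Nat.prime_three⟩
  hodgeConjectureFor_pow_of_forall_of_isCyclotomicExtension (q := 78) (by norm_num) (by decide) units_pow_twelve_seventyEight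
    hW hQ hL hM hA n

/-- `u¹² = 1` for every unit of `ℤ/90`: `(ℤ/90)ˣ ≅ ℤ/2 × ℤ/12` (kernel decision on the residues coprime to `90`).
[cite: Washington1997, Ch. 2 Thm. 2.5] -/
theorem units_pow_twelve_ninety (u : (ZMod 90)ˣ) : u ^ (4 * 3) = 1 := by
  have h : ∀ a : ZMod 90, Nat.Coprime a.val 90 → a ^ 12 = 1 := by decide
  exact Units.ext (by rw [Units.val_pow_eq_pow_val, h _ (ZMod.val_coe_unit_coprime u), Units.val_one])

/-- **`ℚ(ζ₉₀)` (degree `24`, `Gal ≅ ℤ/2 × ℤ/12`): `Rank(Φ) + b(Φ) + 2·e₄(Φ) + 2·e₆(Φ) + 4·e₁₂(Φ) = 13`** for EVERY CM type `Φ` — `b` =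
the number of imaginary quadratic subfields over which `Φ` is of Weil type, `e₄` = the number of CM subfields `F` with `Gal(F/ℚ) ≅ ℤ/4`
every embedding of which has `[ℚ(ζ₉₀):F]/2 = 3` extensions in `Φ`, `e₆` = the number of (cyclic) sextic CM subfields over which `Φ`
is level of exponent `3`, `e₁₂` = the number of CM subfields of degree `12` with cyclic Galois group over which `Φ` is level of
exponent `3`. [cite: Kubota1965, §4 Lemma 2] [cite: Hazama2003CyclicCM, Prop. 4.3] [cite: Dodson1984, §3.1.1 Theorem]
[cite: Gordon1999HodgeAVSurvey, 9.4.3] -/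
theorem cmTypeRank_add_ncard_subfields_ninety [IsCyclotomicExtension {90} ℚ L] (Φ : CMType L) :
    cmTypeRank Φ + {F : IntermediateField ℚ L | Module.finrank ℚ F = 2 ∧ ¬ IsTotallyReal F ∧
        ∀ τ : F →+* ℂ, {φ : L →+* ℂ | φ.comp (algebraMap F L) = τ ∧ φ ∈ Φ.1}.ncard =
          {φ : L →+* ℂ | φ.comp (algebraMap F L) = τ ∧ φ ∉ Φ.1}.ncard}.ncard +
      2 * {F : IntermediateField ℚ L | Module.finrank ℚ F = 4 ∧ ¬ IsTotallyReal F ∧ IsCyclic (F ≃ₐ[ℚ] F) ∧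
        ∀ τ : F →+* ℂ, 2 * {φ : L →+* ℂ | φ.comp (algebraMap F L) = τ ∧ φ ∈ Φ.1}.ncard = Module.finrank F L}.ncard +
      2 * {F : IntermediateField ℚ L | Module.finrank ℚ F = 6 ∧ ¬ IsTotallyReal F ∧
        ∀ σ : F ≃ₐ[ℚ] F, σ ^ (3 : ℕ) = AlgEquiv.refl → ∀ τ : F →+* ℂ,
          {φ : L →+* ℂ | φ.comp (algebraMap F L) = τ.comp σ.toRingEquiv.toRingHom ∧ φ ∈ Φ.1}.ncard =
            {φ : L →+* ℂ | φ.comp (algebraMap F L) = τ ∧ φ ∈ Φ.1}.ncard}.ncard +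
      4 * {F : IntermediateField ℚ L | Module.finrank ℚ F = 12 ∧ ¬ IsTotallyReal F ∧ IsCyclic (F ≃ₐ[ℚ] F) ∧
        ∀ σ : F ≃ₐ[ℚ] F, σ ^ (3 : ℕ) = AlgEquiv.refl → ∀ τ : F →+* ℂ,
          {φ : L →+* ℂ | φ.comp (algebraMap F L) = τ.comp σ.toRingEquiv.toRingHom ∧ φ ∈ Φ.1}.ncard =
            {φ : L →+* ℂ | φ.comp (algebraMap F L) = τ ∧ φ ∈ Φ.1}.ncard}.ncard = 13 := by
  haveI : Fact (Nat.Prime 3) := ⟨Nat.prime_three⟩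
  have h := cmTypeRank_add_ncard_subfields_eq_of_isCyclotomicExtension (L := L) (q := 90) (by norm_num)
    (by decide : (3 : ℕ) ≠ 2) units_pow_twelve_ninety Φ
  have hφ : Nat.totient 90 = 24 := by decide
  rw [hφ] at h
  exact h

/-- **`ℚ(ζ₉₀)`: THE HODGE CONJECTURE FOR ALL POWERS of every abelian variety with complex multiplication by `ℚ(ζ₉₀)` (CM `12`-folds)
whose type is of Weil type over no imaginary quadratic subfield, halves no cyclic quartic CM subfield, and is level of exponent `3`
over no sextic CM subfield and over no cyclic CM subfield of degree `12`** — UNCONDITIONAL.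
[cite: Gordon1999HodgeAVSurvey, Thm. 6.4 and §9.3] [cite: Kubota1965, §4 Lemma 2] -/
theorem hodgeConjectureFor_pow_of_forall_ninety [IsCyclotomicExtension {90} ℚ L]
    (hW : ∀ F : IntermediateField ℚ L, Module.finrank ℚ F = 2 → ¬ IsTotallyReal F →
        ¬ ∀ τ : F →+* ℂ, {φ : L →+* ℂ | φ.comp (algebraMap F L) = τ ∧ φ ∈ Φ.1}.ncard =
          {φ : L →+* ℂ | φ.comp (algebraMap F L) = τ ∧ φ ∉ Φ.1}.ncard)
    (hQ : ∀ F : IntermediateField ℚ L, Module.finrank ℚ F = 4 → ¬ IsTotallyReal F → IsCyclic (F ≃ₐ[ℚ] F) →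
        ¬ ∀ τ : F →+* ℂ, 2 * {φ : L →+* ℂ | φ.comp (algebraMap F L) = τ ∧ φ ∈ Φ.1}.ncard = Module.finrank F L)
    (hL : ∀ F : IntermediateField ℚ L, Module.finrank ℚ F = 2 * 3 → ¬ IsTotallyReal F →
        ¬ ∀ σ : F ≃ₐ[ℚ] F, σ ^ (3 : ℕ) = AlgEquiv.refl → ∀ τ : F →+* ℂ,
          {φ : L →+* ℂ | φ.comp (algebraMap F L) = τ.comp σ.toRingEquiv.toRingHom ∧ φ ∈ Φ.1}.ncard =
            {φ : L →+* ℂ | φ.comp (algebraMap F L) = τ ∧ φ ∈ Φ.1}.ncard)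
    (hM : ∀ F : IntermediateField ℚ L, Module.finrank ℚ F = 4 * 3 → ¬ IsTotallyReal F → IsCyclic (F ≃ₐ[ℚ] F) →
        ¬ ∀ σ : F ≃ₐ[ℚ] F, σ ^ (3 : ℕ) = AlgEquiv.refl → ∀ τ : F →+* ℂ,
          {φ : L →+* ℂ | φ.comp (algebraMap F L) = τ.comp σ.toRingEquiv.toRingHom ∧ φ ∈ Φ.1}.ncard =
            {φ : L →+* ℂ | φ.comp (algebraMap F L) = τ ∧ φ ∈ Φ.1}.ncard)
    (hA : IsCMTypeRealisation Φ A ι θ) (n : ℕ) :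
    HodgeConjectureFor (⨁ fun _ : Fin n => A).dim (⨁ fun _ : Fin n => A).X :=
  haveI : Fact (Nat.Prime 3) := ⟨Nat.prime_three⟩
  hodgeConjectureFor_pow_of_forall_of_isCyclotomicExtension (q := 90) (by norm_num) (by decide) units_pow_twelve_ninety
    hW hQ hL hM hA n

/-! ### The levels `55, 75, 100` (`ℚ(ζ₅₅) = ℚ(ζ₁₁₀)`, `ℚ(ζ₇₅) = ℚ(ζ₁₅₀)`, `ℚ(ζ₁₀₀)`; `(ℤ/q)ˣ ≅ ℤ/2 × ℤ/20`, `φ(q) = 40`, `p = 5`) — appended in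
generation 64 with the lane's «φ(N) = 40» instances (the levels `88, 132` of exponent `10` are appended to `ExponentTwicePrime`; `41, 82`
are cyclic of order `40 = 8·5`, `CyclicTwoPowerTimesPrimeCMTypes`) -/

/-- `u²⁰ = 1` for every unit of `ℤ/55`: `(ℤ/55)ˣ ≅ ℤ/2 × ℤ/20` (kernel decision on the residues coprime to `55`).
[cite: Washington1997, Ch. 2 Thm. 2.5] -/
theorem units_pow_twenty_fiftyFive (u : (ZMod 55)ˣ) : u ^ (4 * 5) = 1 := by
  have h : ∀ a : ZMod 55, Nat.Coprime a.val 55 → a ^ 20 = 1 := by decide +kernel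
  rw [show (4 * 5 : ℕ) = 20 by norm_num]
  exact Units.ext (by rw [Units.val_pow_eq_pow_val, h _ (ZMod.val_coe_unit_coprime u), Units.val_one])

/-- **`ℚ(ζ₅₅)` (degree `40`, `Gal ≅ ℤ/2 × ℤ/20`): `Rank(Φ) + b(Φ) + 2·e₄(Φ) + 4·e₁₀(Φ) + 8·e₂₀(Φ) = 21`** for EVERY CM type `Φ` (`b` Weil imaginary
quadratic subfields, `e₄` halved cyclic quartic CM subfields, `e₁₀` CM subfields of degree `10` over which `Φ` is level of exponent `5`, `e₂₀` CM
subfields of degree `20` with cyclic group over which `Φ` is level of exponent `5`). [cite: Kubota1965, §4 Lemma 2] [cite: Hazama2003CyclicCM, Prop. 4.3]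
[cite: Dodson1984, §3.1.1 Theorem] [cite: Gordon1999HodgeAVSurvey, 9.4.3] -/
theorem cmTypeRank_add_ncard_subfields_fiftyFive [IsCyclotomicExtension {55} ℚ L] (Φ : CMType L) :
    cmTypeRank Φ + {F : IntermediateField ℚ L | Module.finrank ℚ F = 2 ∧ ¬ IsTotallyReal F ∧
        ∀ τ : F →+* ℂ, {φ : L →+* ℂ | φ.comp (algebraMap F L) = τ ∧ φ ∈ Φ.1}.ncard =
          {φ : L →+* ℂ | φ.comp (algebraMap F L) = τ ∧ φ ∉ Φ.1}.ncard}.ncard +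
      2 * {F : IntermediateField ℚ L | Module.finrank ℚ F = 4 ∧ ¬ IsTotallyReal F ∧ IsCyclic (F ≃ₐ[ℚ] F) ∧
        ∀ τ : F →+* ℂ, 2 * {φ : L →+* ℂ | φ.comp (algebraMap F L) = τ ∧ φ ∈ Φ.1}.ncard = Module.finrank F L}.ncard +
      4 * {F : IntermediateField ℚ L | Module.finrank ℚ F = 10 ∧ ¬ IsTotallyReal F ∧
        ∀ σ : F ≃ₐ[ℚ] F, σ ^ (5 : ℕ) = AlgEquiv.refl → ∀ τ : F →+* ℂ,
          {φ : L →+* ℂ | φ.comp (algebraMap F L) = τ.comp σ.toRingEquiv.toRingHom ∧ φ ∈ Φ.1}.ncard =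
            {φ : L →+* ℂ | φ.comp (algebraMap F L) = τ ∧ φ ∈ Φ.1}.ncard}.ncard +
      8 * {F : IntermediateField ℚ L | Module.finrank ℚ F = 20 ∧ ¬ IsTotallyReal F ∧ IsCyclic (F ≃ₐ[ℚ] F) ∧
        ∀ σ : F ≃ₐ[ℚ] F, σ ^ (5 : ℕ) = AlgEquiv.refl → ∀ τ : F →+* ℂ,
          {φ : L →+* ℂ | φ.comp (algebraMap F L) = τ.comp σ.toRingEquiv.toRingHom ∧ φ ∈ Φ.1}.ncard =
            {φ : L →+* ℂ | φ.comp (algebraMap F L) = τ ∧ φ ∈ Φ.1}.ncard}.ncard = 21 := by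
  haveI : Fact (Nat.Prime 5) := ⟨Nat.prime_five⟩
  have h := cmTypeRank_add_ncard_subfields_eq_of_isCyclotomicExtension (L := L) (q := 55) (by norm_num)
    (by decide : (5 : ℕ) ≠ 2) units_pow_twenty_fiftyFive Φ
  have hφ : Nat.totient 55 = 40 := by decide
  rw [hφ] at h
  exact h

/-- **`ℚ(ζ₅₅)`: THE HODGE CONJECTURE FOR ALL POWERS of every abelian variety with complex multiplication by `ℚ(ζ₅₅)` (CM `20`-folds) whose type
is of Weil type over no imaginary quadratic subfield, halves no cyclic quartic CM subfield, and is level of exponent `5` over no CM subfield of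
degree `10` and over no cyclic CM subfield of degree `20`** — UNCONDITIONAL. [cite: Gordon1999HodgeAVSurvey, Thm. 6.4 and §9.3]
[cite: Kubota1965, §4 Lemma 2] -/
theorem hodgeConjectureFor_pow_of_forall_fiftyFive [IsCyclotomicExtension {55} ℚ L]
    (hW : ∀ F : IntermediateField ℚ L, Module.finrank ℚ F = 2 → ¬ IsTotallyReal F →
        ¬ ∀ τ : F →+* ℂ, {φ : L →+* ℂ | φ.comp (algebraMap F L) = τ ∧ φ ∈ Φ.1}.ncard =
          {φ : L →+* ℂ | φ.comp (algebraMap F L) = τ ∧ φ ∉ Φ.1}.ncard)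
    (hQ : ∀ F : IntermediateField ℚ L, Module.finrank ℚ F = 4 → ¬ IsTotallyReal F → IsCyclic (F ≃ₐ[ℚ] F) →
        ¬ ∀ τ : F →+* ℂ, 2 * {φ : L →+* ℂ | φ.comp (algebraMap F L) = τ ∧ φ ∈ Φ.1}.ncard = Module.finrank F L)
    (hL : ∀ F : IntermediateField ℚ L, Module.finrank ℚ F = 2 * 5 → ¬ IsTotallyReal F →
        ¬ ∀ σ : F ≃ₐ[ℚ] F, σ ^ (5 : ℕ) = AlgEquiv.refl → ∀ τ : F →+* ℂ,
          {φ : L →+* ℂ | φ.comp (algebraMap F L) = τ.comp σ.toRingEquiv.toRingHom ∧ φ ∈ Φ.1}.ncard =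
            {φ : L →+* ℂ | φ.comp (algebraMap F L) = τ ∧ φ ∈ Φ.1}.ncard)
    (hM : ∀ F : IntermediateField ℚ L, Module.finrank ℚ F = 4 * 5 → ¬ IsTotallyReal F → IsCyclic (F ≃ₐ[ℚ] F) →
        ¬ ∀ σ : F ≃ₐ[ℚ] F, σ ^ (5 : ℕ) = AlgEquiv.refl → ∀ τ : F →+* ℂ,
          {φ : L →+* ℂ | φ.comp (algebraMap F L) = τ.comp σ.toRingEquiv.toRingHom ∧ φ ∈ Φ.1}.ncard =
            {φ : L →+* ℂ | φ.comp (algebraMap F L) = τ ∧ φ ∈ Φ.1}.ncard)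
    (hA : IsCMTypeRealisation Φ A ι θ) (n : ℕ) :
    HodgeConjectureFor (⨁ fun _ : Fin n => A).dim (⨁ fun _ : Fin n => A).X :=
  haveI : Fact (Nat.Prime 5) := ⟨Nat.prime_five⟩
  hodgeConjectureFor_pow_of_forall_of_isCyclotomicExtension (q := 55) (by norm_num) (by decide) units_pow_twenty_fiftyFive
    hW hQ hL hM hA n

/-- `u²⁰ = 1` for every unit of `ℤ/75`: `(ℤ/75)ˣ ≅ ℤ/2 × ℤ/20` (kernel decision on the residues coprime to `75`).
[cite: Washington1997, Ch. 2 Thm. 2.5] -/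
theorem units_pow_twenty_seventyFive (u : (ZMod 75)ˣ) : u ^ (4 * 5) = 1 := by
  have h : ∀ a : ZMod 75, Nat.Coprime a.val 75 → a ^ 20 = 1 := by decide +kernel
  rw [show (4 * 5 : ℕ) = 20 by norm_num]
  exact Units.ext (by rw [Units.val_pow_eq_pow_val, h _ (ZMod.val_coe_unit_coprime u), Units.val_one])

/-- **`ℚ(ζ₇₅)` (degree `40`, `Gal ≅ ℤ/2 × ℤ/20`): `Rank(Φ) + b(Φ) + 2·e₄(Φ) + 4·e₁₀(Φ) + 8·e₂₀(Φ) = 21`** for EVERY CM type `Φ` (`b` Weil imaginary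
quadratic subfields, `e₄` halved cyclic quartic CM subfields, `e₁₀` CM subfields of degree `10` over which `Φ` is level of exponent `5`, `e₂₀` CM
subfields of degree `20` with cyclic group over which `Φ` is level of exponent `5`). [cite: Kubota1965, §4 Lemma 2] [cite: Hazama2003CyclicCM, Prop. 4.3]
[cite: Dodson1984, §3.1.1 Theorem] [cite: Gordon1999HodgeAVSurvey, 9.4.3] -/
theorem cmTypeRank_add_ncard_subfields_seventyFive [IsCyclotomicExtension {75} ℚ L] (Φ : CMType L) :
    cmTypeRank Φ + {F : IntermediateField ℚ L | Module.finrank ℚ F = 2 ∧ ¬ IsTotallyReal F ∧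
        ∀ τ : F →+* ℂ, {φ : L →+* ℂ | φ.comp (algebraMap F L) = τ ∧ φ ∈ Φ.1}.ncard =
          {φ : L →+* ℂ | φ.comp (algebraMap F L) = τ ∧ φ ∉ Φ.1}.ncard}.ncard +
      2 * {F : IntermediateField ℚ L | Module.finrank ℚ F = 4 ∧ ¬ IsTotallyReal F ∧ IsCyclic (F ≃ₐ[ℚ] F) ∧
        ∀ τ : F →+* ℂ, 2 * {φ : L →+* ℂ | φ.comp (algebraMap F L) = τ ∧ φ ∈ Φ.1}.ncard = Module.finrank F L}.ncard +
      4 * {F : IntermediateField ℚ L | Module.finrank ℚ F = 10 ∧ ¬ IsTotallyReal F ∧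
        ∀ σ : F ≃ₐ[ℚ] F, σ ^ (5 : ℕ) = AlgEquiv.refl → ∀ τ : F →+* ℂ,
          {φ : L →+* ℂ | φ.comp (algebraMap F L) = τ.comp σ.toRingEquiv.toRingHom ∧ φ ∈ Φ.1}.ncard =
            {φ : L →+* ℂ | φ.comp (algebraMap F L) = τ ∧ φ ∈ Φ.1}.ncard}.ncard +
      8 * {F : IntermediateField ℚ L | Module.finrank ℚ F = 20 ∧ ¬ IsTotallyReal F ∧ IsCyclic (F ≃ₐ[ℚ] F) ∧
        ∀ σ : F ≃ₐ[ℚ] F, σ ^ (5 : ℕ) = AlgEquiv.refl → ∀ τ : F →+* ℂ,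
          {φ : L →+* ℂ | φ.comp (algebraMap F L) = τ.comp σ.toRingEquiv.toRingHom ∧ φ ∈ Φ.1}.ncard =
            {φ : L →+* ℂ | φ.comp (algebraMap F L) = τ ∧ φ ∈ Φ.1}.ncard}.ncard = 21 := by
  haveI : Fact (Nat.Prime 5) := ⟨Nat.prime_five⟩
  have h := cmTypeRank_add_ncard_subfields_eq_of_isCyclotomicExtension (L := L) (q := 75) (by norm_num)
    (by decide : (5 : ℕ) ≠ 2) units_pow_twenty_seventyFive Φ
  have hφ : Nat.totient 75 = 40 := by decide
  rw [hφ] at h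
  exact h

/-- **`ℚ(ζ₇₅)`: THE HODGE CONJECTURE FOR ALL POWERS of every abelian variety with complex multiplication by `ℚ(ζ₇₅)` (CM `20`-folds) whose type
is of Weil type over no imaginary quadratic subfield, halves no cyclic quartic CM subfield, and is level of exponent `5` over no CM subfield of
degree `10` and over no cyclic CM subfield of degree `20`** — UNCONDITIONAL. [cite: Gordon1999HodgeAVSurvey, Thm. 6.4 and §9.3]
[cite: Kubota1965, §4 Lemma 2] -/
theorem hodgeConjectureFor_pow_of_forall_seventyFive [IsCyclotomicExtension {75} ℚ L]
    (hW : ∀ F : IntermediateField ℚ L, Module.finrank ℚ F = 2 → ¬ IsTotallyReal F →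
        ¬ ∀ τ : F →+* ℂ, {φ : L →+* ℂ | φ.comp (algebraMap F L) = τ ∧ φ ∈ Φ.1}.ncard =
          {φ : L →+* ℂ | φ.comp (algebraMap F L) = τ ∧ φ ∉ Φ.1}.ncard)
    (hQ : ∀ F : IntermediateField ℚ L, Module.finrank ℚ F = 4 → ¬ IsTotallyReal F → IsCyclic (F ≃ₐ[ℚ] F) →
        ¬ ∀ τ : F →+* ℂ, 2 * {φ : L →+* ℂ | φ.comp (algebraMap F L) = τ ∧ φ ∈ Φ.1}.ncard = Module.finrank F L)
    (hL : ∀ F : IntermediateField ℚ L, Module.finrank ℚ F = 2 * 5 → ¬ IsTotallyReal F →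
        ¬ ∀ σ : F ≃ₐ[ℚ] F, σ ^ (5 : ℕ) = AlgEquiv.refl → ∀ τ : F →+* ℂ,
          {φ : L →+* ℂ | φ.comp (algebraMap F L) = τ.comp σ.toRingEquiv.toRingHom ∧ φ ∈ Φ.1}.ncard =
            {φ : L →+* ℂ | φ.comp (algebraMap F L) = τ ∧ φ ∈ Φ.1}.ncard)
    (hM : ∀ F : IntermediateField ℚ L, Module.finrank ℚ F = 4 * 5 → ¬ IsTotallyReal F → IsCyclic (F ≃ₐ[ℚ] F) →
        ¬ ∀ σ : F ≃ₐ[ℚ] F, σ ^ (5 : ℕ) = AlgEquiv.refl → ∀ τ : F →+* ℂ,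
          {φ : L →+* ℂ | φ.comp (algebraMap F L) = τ.comp σ.toRingEquiv.toRingHom ∧ φ ∈ Φ.1}.ncard =
            {φ : L →+* ℂ | φ.comp (algebraMap F L) = τ ∧ φ ∈ Φ.1}.ncard)
    (hA : IsCMTypeRealisation Φ A ι θ) (n : ℕ) :
    HodgeConjectureFor (⨁ fun _ : Fin n => A).dim (⨁ fun _ : Fin n => A).X :=
  haveI : Fact (Nat.Prime 5) := ⟨Nat.prime_five⟩
  hodgeConjectureFor_pow_of_forall_of_isCyclotomicExtension (q := 75) (by norm_num) (by decide) units_pow_twenty_seventyFive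
    hW hQ hL hM hA n

/-- `u²⁰ = 1` for every unit of `ℤ/100`: `(ℤ/100)ˣ ≅ ℤ/2 × ℤ/20` (kernel decision on the residues coprime to `100`).
[cite: Washington1997, Ch. 2 Thm. 2.5] -/
theorem units_pow_twenty_oneHundred (u : (ZMod 100)ˣ) : u ^ (4 * 5) = 1 := by
  have h : ∀ a : ZMod 100, Nat.Coprime a.val 100 → a ^ 20 = 1 := by decide +kernel
  rw [show (4 * 5 : ℕ) = 20 by norm_num]
  exact Units.ext (by rw [Units.val_pow_eq_pow_val, h _ (ZMod.val_coe_unit_coprime u), Units.val_one])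

/-- **`ℚ(ζ₁₀₀)` (degree `40`, `Gal ≅ ℤ/2 × ℤ/20`): `Rank(Φ) + b(Φ) + 2·e₄(Φ) + 4·e₁₀(Φ) + 8·e₂₀(Φ) = 21`** for EVERY CM type `Φ` (`b` Weil imaginary
quadratic subfields, `e₄` halved cyclic quartic CM subfields, `e₁₀` CM subfields of degree `10` over which `Φ` is level of exponent `5`, `e₂₀` CM
subfields of degree `20` with cyclic group over which `Φ` is level of exponent `5`). [cite: Kubota1965, §4 Lemma 2] [cite: Hazama2003CyclicCM, Prop. 4.3]
[cite: Dodson1984, §3.1.1 Theorem] [cite: Gordon1999HodgeAVSurvey, 9.4.3] -/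
theorem cmTypeRank_add_ncard_subfields_oneHundred [IsCyclotomicExtension {100} ℚ L] (Φ : CMType L) :
    cmTypeRank Φ + {F : IntermediateField ℚ L | Module.finrank ℚ F = 2 ∧ ¬ IsTotallyReal F ∧
        ∀ τ : F →+* ℂ, {φ : L →+* ℂ | φ.comp (algebraMap F L) = τ ∧ φ ∈ Φ.1}.ncard =
          {φ : L →+* ℂ | φ.comp (algebraMap F L) = τ ∧ φ ∉ Φ.1}.ncard}.ncard +
      2 * {F : IntermediateField ℚ L | Module.finrank ℚ F = 4 ∧ ¬ IsTotallyReal F ∧ IsCyclic (F ≃ₐ[ℚ] F) ∧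
        ∀ τ : F →+* ℂ, 2 * {φ : L →+* ℂ | φ.comp (algebraMap F L) = τ ∧ φ ∈ Φ.1}.ncard = Module.finrank F L}.ncard +
      4 * {F : IntermediateField ℚ L | Module.finrank ℚ F = 10 ∧ ¬ IsTotallyReal F ∧
        ∀ σ : F ≃ₐ[ℚ] F, σ ^ (5 : ℕ) = AlgEquiv.refl → ∀ τ : F →+* ℂ,
          {φ : L →+* ℂ | φ.comp (algebraMap F L) = τ.comp σ.toRingEquiv.toRingHom ∧ φ ∈ Φ.1}.ncard =
            {φ : L →+* ℂ | φ.comp (algebraMap F L) = τ ∧ φ ∈ Φ.1}.ncard}.ncard +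
      8 * {F : IntermediateField ℚ L | Module.finrank ℚ F = 20 ∧ ¬ IsTotallyReal F ∧ IsCyclic (F ≃ₐ[ℚ] F) ∧
        ∀ σ : F ≃ₐ[ℚ] F, σ ^ (5 : ℕ) = AlgEquiv.refl → ∀ τ : F →+* ℂ,
          {φ : L →+* ℂ | φ.comp (algebraMap F L) = τ.comp σ.toRingEquiv.toRingHom ∧ φ ∈ Φ.1}.ncard =
            {φ : L →+* ℂ | φ.comp (algebraMap F L) = τ ∧ φ ∈ Φ.1}.ncard}.ncard = 21 := by
  haveI : Fact (Nat.Prime 5) := ⟨Nat.prime_five⟩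
  have h := cmTypeRank_add_ncard_subfields_eq_of_isCyclotomicExtension (L := L) (q := 100) (by norm_num)
    (by decide : (5 : ℕ) ≠ 2) units_pow_twenty_oneHundred Φ
  have hφ : Nat.totient 100 = 40 := by decide
  rw [hφ] at h
  exact h

/-- **`ℚ(ζ₁₀₀)`: THE HODGE CONJECTURE FOR ALL POWERS of every abelian variety with complex multiplication by `ℚ(ζ₁₀₀)` (CM `20`-folds) whose type
is of Weil type over no imaginary quadratic subfield, halves no cyclic quartic CM subfield, and is level of exponent `5` over no CM subfield of
degree `10` and over no cyclic CM subfield of degree `20`** — UNCONDITIONAL. [cite: Gordon1999HodgeAVSurvey, Thm. 6.4 and §9.3]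
[cite: Kubota1965, §4 Lemma 2] -/
theorem hodgeConjectureFor_pow_of_forall_oneHundred [IsCyclotomicExtension {100} ℚ L]
    (hW : ∀ F : IntermediateField ℚ L, Module.finrank ℚ F = 2 → ¬ IsTotallyReal F →
        ¬ ∀ τ : F →+* ℂ, {φ : L →+* ℂ | φ.comp (algebraMap F L) = τ ∧ φ ∈ Φ.1}.ncard =
          {φ : L →+* ℂ | φ.comp (algebraMap F L) = τ ∧ φ ∉ Φ.1}.ncard)
    (hQ : ∀ F : IntermediateField ℚ L, Module.finrank ℚ F = 4 → ¬ IsTotallyReal F → IsCyclic (F ≃ₐ[ℚ] F) →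
        ¬ ∀ τ : F →+* ℂ, 2 * {φ : L →+* ℂ | φ.comp (algebraMap F L) = τ ∧ φ ∈ Φ.1}.ncard = Module.finrank F L)
    (hL : ∀ F : IntermediateField ℚ L, Module.finrank ℚ F = 2 * 5 → ¬ IsTotallyReal F →
        ¬ ∀ σ : F ≃ₐ[ℚ] F, σ ^ (5 : ℕ) = AlgEquiv.refl → ∀ τ : F →+* ℂ,
          {φ : L →+* ℂ | φ.comp (algebraMap F L) = τ.comp σ.toRingEquiv.toRingHom ∧ φ ∈ Φ.1}.ncard =
            {φ : L →+* ℂ | φ.comp (algebraMap F L) = τ ∧ φ ∈ Φ.1}.ncard)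
    (hM : ∀ F : IntermediateField ℚ L, Module.finrank ℚ F = 4 * 5 → ¬ IsTotallyReal F → IsCyclic (F ≃ₐ[ℚ] F) →
        ¬ ∀ σ : F ≃ₐ[ℚ] F, σ ^ (5 : ℕ) = AlgEquiv.refl → ∀ τ : F →+* ℂ,
          {φ : L →+* ℂ | φ.comp (algebraMap F L) = τ.comp σ.toRingEquiv.toRingHom ∧ φ ∈ Φ.1}.ncard =
            {φ : L →+* ℂ | φ.comp (algebraMap F L) = τ ∧ φ ∈ Φ.1}.ncard)
    (hA : IsCMTypeRealisation Φ A ι θ) (n : ℕ) :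
    HodgeConjectureFor (⨁ fun _ : Fin n => A).dim (⨁ fun _ : Fin n => A).X :=
  haveI : Fact (Nat.Prime 5) := ⟨Nat.prime_five⟩
  hodgeConjectureFor_pow_of_forall_of_isCyclotomicExtension (q := 100) (by norm_num) (by decide) units_pow_twenty_oneHundred
    hW hQ hL hM hA n

end Cyclotomic

end ExponentFourTimesPrime

end Literature.AlgebraicGeometry.Pohlmann1968

end
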